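import Mathlib.Analysis.Calculus.MeanValue
import Mathlib.Analysis.Calculus.LocalExtr.Basic
import Mathlib.Analysis.SpecialFunctions.Pow.Deriv
import Literature.Analysis.FluidPDE.GeneralizedAxisymNS
import HarnessLib

/-!
# Luo–Hou's exact self-similar ansatz for axisymmetric Euler is trivial
# (Chae–Tsai 2015, Thm. 1) — and, without decay, trivial or a stationary singular swirl
# (Sperone 2017, Prop. 3.1)

Analysis/FluidPDE proof file: theorems only (no definitions, no named facts, no `sorry`), in the
vocabulary of `GeneralizedAxisymNS` (whose case `n = 3`, `ν = 0` IS the `(u₁, ω₁, ψ₁)`-form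
(01)–(03) of the axisymmetric Euler equations used by both sources) and of the meridian partial
derivatives `derivR`, `derivZ` of that file.

## Sources (held; page numbers `p.` = arXiv rendering)

* D. Chae, T.-P. Tsai, *Remark on Luo–Hou's ansatz for a self-similar solution to the 3D Euler
  equations*, J. Nonlinear Sci. **25** (2015) 193–202 = arXiv:1402.4560 [`ChaeTsai2015`]:
  §1 (01)–(03) (the `(u₁, ω₁, ψ₁) = (u^θ/r, ω^θ/r, ψ^θ/r)` system, `u^r = −r∂_zψ₁`,
  `u^z = 2ψ₁ + r∂_rψ₁`), §2 (11)–(13) (Luo–Hou's ansatz `u₁ = (T−t)^{−1+γ/2}U(R,Z)`,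
  `ω₁ = (T−t)^{−1}Ω(R,Z)`, `ψ₁ = (T−t)^{−1+2γ}Ψ(R,Z)`, `R = (r−1)/(T−t)^γ`, `Z = z/(T−t)^γ`),
  the regions `𝒞_{δ,T}` and `𝒲_{δ(t)}`, **Theorem 1** and its proof ((16)–(24)), §4 Discussion.
* G. Sperone, *Further remarks on the Luo–Hou's ansatz for a self-similar solution to the 3D Euler
  equations*, J. Nonlinear Sci. **27** (2017) 1325–1338 = arXiv:1708.09648 [`Sperone2017`]:
  §3 **Proposition 3.1** and its proof ((3.4)–(3.25)).
* G. Luo, T. Y. Hou, PNAS 111 (2014) / Multiscale Model. Simul. 12 (2014) = arXiv:1310.0497,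
  §4.7 (the ansatz and the fitted `γ ≈ 2.91`) — the numerics the two notes address; typed
  elsewhere in the tree (`LuoHou2014BoundaryScenario.lean`), NOT used here.

> **Chae–Tsai, Theorem 1.** Let `(u₁, ω₁, ψ₁)` be a classical solution to the system (01)–(03)
> with the representation (11)–(13), `0 < γ < ∞`, in either the set
> `𝒞_{δ,T} = {1−δ < r < 1, −δ < z < δ, T−δ < t < T}` […], or in the set `𝒲_{δ(t)}` [a window
> shrinking to the boundary circle with `limsup_{t→T−}(T−t)^{−γ}δ(t) = ∞`]. We assume
> `|U(Y)| + |Ω(Y)| = o(1)`. Then `u₁ = ω₁ = 0`, and `ψ₁ = a(T−t)^{−1+γ}z + b(T−t)^{−1+2γ}`.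
>
> **Sperone, Proposition 3.1.** [Same setting on `𝒞(δ,T)`, no decay assumed.] Then the trio
> leads to an over-determined system of PDEs that produces two families of solutions:
> 1. `u₁ = 0`, `ω₁ = 0`, `ψ₁ = b(T−t)^{−1+γ}z + c(T−t)^{−1+2γ}`;
> 2. `u₁ = κ(1−r)^{(γ−2)/(2γ)}`, `ω₁ = 0`, `ψ₁ = c(T−t)^{−1+2γ}` (stationary, singular at `r = 1`).

The mechanism (both papers): substituting the ansatz into (01)–(03), "the terms […] do not have
equal factors of powers of `T−t`. Indeed, they differ by integer powers of `(T−t)^γ`"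
(Chae–Tsai §3): with `s = (T−t)^γ` each equation reads `A(Y) + s·B(Y) = 0` at the fixed profile
point `Y = (R, Z)` for all small `s`, whence the leading-order profile system (19)–(21)
((1−γ/2)U + γY·∇U + ∇⊥Ψ·∇U = 0, Ω + γY·∇Ω + ∇⊥Ψ·∇Ω = ∂_Z(U²), −ΔΨ = Ω; `∇⊥ = (−∂_Z, ∂_R)`)
AND the next-order system (22)–(24) (`R∇⊥Ψ·∇U + 2Ψ∂_ZU = 2U∂_ZΨ`, `R∇⊥Ψ·∇Ω + 2Ψ∂_ZΩ = 0`,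
`∂_RΨ = 0`) must hold together — an over-determined system whose solutions are classified by
one-variable arguments.

## Contents (namespace `Literature.Analysis.FluidPDE`, helpers in `….LuoHouAnsatz`)

* One-variable lemmas: `LuoHouAnsatz.eq_zero_of_euler_ode` (Chae–Tsai's "maximum principle"
  for `cv + γZv' = 0` with decay at `±∞`), `LuoHouAnsatz.exists_eq_mul_rpow_of_euler_ode_Iio`
  (Sperone's Case (B): `cg + γRg' = 0` on `R < 0` ⇒ `g = κ(−R)^{−c/γ}`); private plumbing (sign
  rigidity under the intermediate value theorem, affine functions from `φ'' = 0`, slices of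
  `C¹`/`C²` profiles on the open left half-plane `𝒟 = {R < 0}` and their derivative dictionaries,
  power bookkeeping).
* Calculus of the rescaled profiles `q ↦ c·G((r−1)/s, z/s)` (`LuoHouAnsatz.derivR_rescale`,
  `…derivZ_rescale`, second partials `…derivR_derivR_derivZ_derivZ_rescale`, and the time
  derivative `LuoHouAnsatz.hasDerivAt_rescale_time`:
  `∂_t[(T−t)^a G(R,Z)] = (T−t)^{a−1}(−aG + γ(R∂_R + Z∂_Z)G)`); `LuoHouAnsatz.stream_reduce` /
  `…vorticity_reduce` ((24) ⇒ `Ψ = Ψ(Z)`; (21) ⇒ `Ω = Ω(Z) = −Ψ''`).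
* `LuoHouAnsatz.substitution` — (16)–(18): at a point where the equations hold and the slices
  agree with the ansatz nearby, `[(19)-part] + s·[(22)-part] = 0` etc., with `s = (T−t)^γ`.
* `LuoHouAnsatz.profileSystem_of_region` / `…_of_window` — (19)–(24) at every `Y ∈ 𝒟` from the
  ansatz on `𝒞_{δ,T}` / on `𝒲_{δ(t)}` (two distinct admissible scales separate the orders,
  `LuoHouAnsatz.coeff_eq_zero_of_two_scales`).
* `LuoHouAnsatz.profile_trivial_of_decay` — **Chae–Tsai's Theorem 1 at the profile level**:
  (19), (20), (21), (24) + decay ⇒ `U = Ω = 0`, `Ψ = aZ + b` (proof as printed).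
* `LuoHouAnsatz.profile_classification` — **Sperone's Proposition 3.1 at the profile level**:
  (19)–(24) ⇒ `U = Ω = 0, Ψ = bZ + c` or `Ω = 0, Ψ = c, U = κ(−R)^{1/2−1/γ}` (proof as printed,
  except that the case "`Ω ≡ a ≠ 0`" is closed by the one-line remark that (20) would give
  `U(R,Z)² = U(R,0)² + aZ < 0` for suitable `Z`, where print takes limits `Z → +∞`, `R → −∞`).
* **As printed**: `chaeTsai2015_luoHouAnsatz_trivial` (Thm. 1 on `𝒞_{δ,T}`),
  `chaeTsai2015_luoHouAnsatz_trivial_of_window` (Thm. 1 on `𝒲_{δ(t)}`),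
  `sperone2017_luoHouAnsatz_classification` (Prop. 3.1), each with the profile-level conclusion
  and the conclusion for `(u₁, ω₁, ψ₁)` on the region.

## Rendering (never stronger than print)

* "Classical solution to (01)–(03) with the representation (11)–(13) in the region" is rendered
  by: the pointwise equations `GeneralizedAxisymNS S 3 0 u₁ ω₁ ψ₁ t q` at the points of the
  region only (any time set `S` containing the region's open time interval, the convention of
  `IsClassicalNSSolutionOn`); the ansatz as pointwise identities on the region; the profiles
  `U, Ω ∈ C¹`, `Ψ ∈ C²` on the OPEN left half-plane `{R < 0}` (which is what a classical
  `(u₁, ω₁, ψ₁)` gives through the ansatz; the line `R = 0`, i.e. the wall `r = 1`, is never the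
  image of a point `r < 1`, and Theorem 1 / Prop. 3.1 use no boundary condition there — Chae–Tsai
  Remark after Thm. 1: "There is no boundary condition for (01)–(03) at `r = 1`"). For the window
  `𝒲_{δ(t)}`, whose time slices only contain the PAST of each of their points (`δ` non-increasing),
  the time-differentiability of `u₁(·, q)`, `ω₁(·, q)` (part of "classical") is an explicit
  hypothesis; `limsup (T−t)^{−γ}δ(t) = ∞` is unpacked as stated in the docstring.
* Decay (26) `|U(Y)| + |Ω(Y)| = o(1)`: `∀ ε > 0 ∃ M ∀ Y ∈ 𝒟, M ≤ ‖Y‖ → |U Y| + |Ω Y| < ε`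
  (`‖·‖` the sup norm of `ℝ × ℝ`; any norm gives the same notion).
* `γ > 0` as printed (Luo–Hou: `γ ≈ 2.91`; Chae–Tsai also note `γ ≥ 2/5` from energy).
* Exponents: `(T−t)^{−1+γ/2}`, `(T−t)^{−1+2γ}` are real powers (`Real.rpow`, `T − t > 0`),
  `(T−t)^{−1}` is written `(T−t)⁻¹`; Sperone's `(1−r)^{(γ−2)/(2γ)}` is a real power of `1−r > 0`.

## What this is NOT

Not a statement about Navier–Stokes, and not a statement about Luo–Hou's COMPUTATION: the
theorems say that the EXACT self-similar ansatz, imposed on a fixed neighbourhood of the ring (or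
on a window shrinking slower than `(T−t)^γ`), is incompatible with the Euler equations unless the
vorticity vanishes there (and, without decay, up to the explicit stationary swirl that is singular
at the wall for all times) — "the self-similar ansatz may be valid either only in a time-dependent
region which shrinks to the boundary circle at the self-similar rate, or under different boundary
conditions at spatial infinity of the self-similar profile" (Chae–Tsai, abstract). Chae–Tsai's
Theorem 2 (the generalized ansatz `Σ_k (T−t)^{kγ}U_k` with the wall condition `∂_ZΨ_k|_{R=0} = 0`)
and Sperone's §3 BKM discussion of family 2 are not typed. `-- TODO(general form): Thm. 2.`

## Mathlib / tree search

`lean search 'ChaeTsai|1402.4560|1708.09648|LuoHou.*[Aa]nsatz'` (2026-08-27): the tree cites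
`ChaeTsai2014` = the Math. Res. Lett. DSS paper only (`LogPeriodicEulerCone.lean`); no statement of
either J. Nonlinear Sci. note. Tree vocabulary used: `GeneralizedAxisymNS` (pointwise structure:
`swirl_eq`, `vorticity_eq`, `stream_eq`), `GeneralizedAxisymNS.radialVel/axialVel/lap`, `derivR`,
`derivZ`, `derivR_eq_deriv`, `derivZ_eq_deriv` (`GeneralizedAxisymNS.lean`), `timeDerivWithin`
(`ClassicalSolution.lean`). Mathlib: `IsOpen.is_const_of_deriv_eq_zero`,
`is_const_of_deriv_eq_zero`, `IsLocalMax.deriv_eq_zero`, `IsCompact.exists_isMaxOn`,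
`IsPreconnected.intermediate_value`, `HasDerivAt.rpow_const`, `Real.rpow_*` algebra,
`Filter.EventuallyEq.fderiv_eq/deriv_eq/derivWithin_eq`, `ContDiffOn.fderiv_of_isOpen`.

## References

* D. Chae, T.-P. Tsai, J. Nonlinear Sci. 25 (2015) 193–202, doi:10.1007/s00332-014-9225-6,
  arXiv:1402.4560: §1 (01)–(03), §2 (11)–(14), (16)–(24), Thm. 1, §4. [ChaeTsai2015]
* G. Sperone, J. Nonlinear Sci. 27 (2017) 1325–1338, doi:10.1007/s00332-017-9363-8,
  arXiv:1708.09648: §3 Prop. 3.1 with (3.4)–(3.25). [Sperone2017]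
* T. Y. Hou, arXiv:2405.10916, §2 (the `(u₁, ω₁, ψ₁)` reformulation = `GeneralizedAxisymNS`,
  `n = 3`). [Hou2026]
-/

noncomputable section

open Set Function Filter
open scoped Topology

namespace Literature.Analysis.FluidPDE

namespace LuoHouAnsatz

/-! ### One-variable lemmas -/

/-- Sign rigidity: a continuous function on a preconnected set whose square is constant is
constant (intermediate value theorem). [folklore] -/
private theorem eq_of_sq_eq_sq_of_continuousOn {s : Set ℝ} (hs : IsPreconnected s) {f : ℝ → ℝ}
    (hf : ContinuousOn f s) {x₀ : ℝ} (hx₀ : x₀ ∈ s) (h : ∀ x ∈ s, f x ^ 2 = f x₀ ^ 2)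
    {x : ℝ} (hx : x ∈ s) : f x = f x₀ := by
  rcases sq_eq_sq_iff_eq_or_eq_neg.1 (h x hx) with h1 | h1
  · exact h1
  · by_cases h0 : f x₀ = 0
    · rw [h1, h0, neg_zero]
    · exfalso
      -- `f` takes the values `f x₀` and `-f x₀` on `s`, hence vanishes somewhere on `s`
      have hIVT : ∃ c ∈ s, f c = 0 := by
        rcases lt_or_gt_of_ne h0 with hneg | hpos
        · -- f x₀ < 0 < f x = -f x₀
          have h01 : (0 : ℝ) ∈ Icc (f x₀) (f x) := ⟨hneg.le, by rw [h1]; linarith⟩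
          obtain ⟨c, hc, hfc⟩ := hs.intermediate_value hx₀ hx hf h01
          exact ⟨c, hc, hfc⟩
        · have h01 : (0 : ℝ) ∈ Icc (f x) (f x₀) := ⟨by rw [h1]; linarith, hpos.le⟩
          obtain ⟨c, hc, hfc⟩ := hs.intermediate_value hx hx₀ hf h01
          exact ⟨c, hc, hfc⟩
      obtain ⟨c, hc, hfc⟩ := hIVT
      have := h c hc
      rw [hfc] at this
      have h00 : f x₀ ^ 2 = 0 := by simpa using this.symm
      exact h0 (pow_eq_zero_iff (n := 2) two_ne_zero |>.1 h00)

/-- Maximum principle for the linear Euler-type equation `c v + γ Z v' = 0` on `ℝ` (`γ > 0`):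
a differentiable solution tending to `0` at `±∞` vanishes identically. For `c ≠ 0`: at a
point of positive maximum (which exists by decay) `v' = 0`, so `c v = 0`; for `c = 0` the
equation gives `v' = 0` off the origin. (Chae–Tsai's "maximum principle together with the
condition `|U| = o(1)`".) [cite: ChaeTsai2015, §2 proof of Thm. 1 (arXiv p. 5)] -/
theorem eq_zero_of_euler_ode {v : ℝ → ℝ} {c γ : ℝ} (hγ : 0 < γ) (hv : Differentiable ℝ v)
    (hode : ∀ z, c * v z + γ * z * deriv v z = 0)
    (htop : Tendsto v atTop (𝓝 0)) (hbot : Tendsto v atBot (𝓝 0)) (z : ℝ) : v z = 0 := by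
  by_cases hc : c = 0
  · -- `c = 0`: `v' = 0` off the origin, so `v` is constant on `(0,∞)` and on `(-∞,0)`
    have hder : ∀ x : ℝ, x ≠ 0 → deriv v x = 0 := by
      intro x hx
      have := hode x
      rw [hc, zero_mul, zero_add] at this
      rcases mul_eq_zero.1 this with h | h
      · rcases mul_eq_zero.1 h with h' | h'
        · exact absurd h' hγ.ne'
        · exact absurd h' hx
      · exact h
    have hpos : ∀ x : ℝ, 0 < x → v x = 0 := by
      have hconst : ∀ x : ℝ, 0 < x → v x = v 1 := fun x hx =>
        isOpen_Ioi.is_const_of_deriv_eq_zero isPreconnected_Ioi hv.differentiableOn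
          (fun y hy => hder y (ne_of_gt hy)) hx (mem_Ioi.2 zero_lt_one)
      have h1 : v 1 = 0 := by
        have : Tendsto (fun _ : ℝ => v 1) atTop (𝓝 0) :=
          htop.congr' ((eventually_gt_atTop 0).mono fun x hx => hconst x hx)
        exact tendsto_nhds_unique this tendsto_const_nhds ▸ rfl
      intro x hx; rw [hconst x hx, h1]
    have hneg : ∀ x : ℝ, x < 0 → v x = 0 := by
      have hconst : ∀ x : ℝ, x < 0 → v x = v (-1) := fun x hx =>
        isOpen_Iio.is_const_of_deriv_eq_zero isPreconnected_Iio hv.differentiableOn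
          (fun y hy => hder y (ne_of_lt hy)) hx (by norm_num)
      have h1 : v (-1) = 0 := by
        have : Tendsto (fun _ : ℝ => v (-1)) atBot (𝓝 0) :=
          hbot.congr' ((eventually_lt_atBot 0).mono fun x hx => hconst x hx)
        exact tendsto_nhds_unique this tendsto_const_nhds ▸ rfl
      intro x hx; rw [hconst x hx, h1]
    rcases lt_trichotomy z 0 with hz | hz | hz
    · exact hneg z hz
    · -- continuity at the origin
      subst hz
      have hcont : Tendsto v (𝓝[>] (0 : ℝ)) (𝓝 (v 0)) :=
        (hv.continuous.tendsto 0).mono_left nhdsWithin_le_nhds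
      have hzero : Tendsto v (𝓝[>] (0 : ℝ)) (𝓝 0) :=
        tendsto_const_nhds.congr' (eventually_nhdsWithin_of_forall fun x hx => (hpos x hx).symm)
      exact tendsto_nhds_unique hcont hzero
    · exact hpos z hz
  · -- `c ≠ 0`: maximum principle, applied to `v` and to `-v`
    have key : ∀ w : ℝ → ℝ, Differentiable ℝ w → (∀ z, c * w z + γ * z * deriv w z = 0) →
        Tendsto w atTop (𝓝 0) → Tendsto w atBot (𝓝 0) → ∀ z, w z ≤ 0 := by
      intro w hw hwode hwtop hwbot
      by_contra! hcon
      obtain ⟨z₀, hz₀⟩ := hcon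
      set ε : ℝ := w z₀ / 2 with hε
      have hε0 : 0 < ε := by rw [hε]; linarith
      obtain ⟨M₁, hM₁⟩ := eventually_atTop.1 ((Metric.tendsto_nhds.1 hwtop) ε hε0)
      obtain ⟨M₂, hM₂⟩ := eventually_atBot.1 ((Metric.tendsto_nhds.1 hwbot) ε hε0)
      set K : Set ℝ := Icc (min M₂ z₀) (max M₁ z₀) with hK
      have hKc : IsCompact K := isCompact_Icc
      have hz₀K : z₀ ∈ K := ⟨min_le_right _ _, le_max_right _ _⟩
      obtain ⟨z₁, hz₁K, hmax⟩ := hKc.exists_isMaxOn ⟨z₀, hz₀K⟩ hw.continuous.continuousOn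
      have hz₁ : w z₀ ≤ w z₁ := hmax hz₀K
      -- global maximum
      have hglob : ∀ y, w y ≤ w z₁ := by
        intro y
        by_cases hy : y ∈ K
        · exact hmax hy
        · rw [hK, mem_Icc, not_and_or, not_le, not_le] at hy
          rcases hy with hy | hy
          · have := hM₂ y (le_trans hy.le (min_le_left _ _))
            rw [Real.dist_eq, sub_zero] at this
            linarith [(abs_lt.1 this).2]
          · have := hM₁ y (le_trans (le_max_left _ _) hy.le)
            rw [Real.dist_eq, sub_zero] at this
            linarith [(abs_lt.1 this).2]
      have hloc : IsLocalMax w z₁ := Filter.Eventually.of_forall hglob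
      have hd := hloc.deriv_eq_zero
      have := hwode z₁
      rw [hd, mul_zero, add_zero] at this
      rcases mul_eq_zero.1 this with h | h
      · exact hc h
      · linarith
    have h1 := key v hv hode htop hbot z
    have h2 : -v z ≤ 0 := by
      refine key (fun y => -v y) hv.neg (fun y => ?_) ?_ ?_ z
      · rw [deriv.fun_neg]; linear_combination (-1 : ℝ) * hode y
      · simpa using htop.neg
      · simpa using hbot.neg
    linarith

/-- A twice differentiable function on `ℝ` with vanishing second derivative is affine.
[folklore] -/
private theorem exists_affine_of_deriv_deriv_eq_zero {φ : ℝ → ℝ} (h1 : Differentiable ℝ φ)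
    (h2 : Differentiable ℝ (deriv φ)) (h0 : ∀ z, deriv (deriv φ) z = 0) :
    ∃ a b : ℝ, ∀ z, φ z = a * z + b := by
  have ha : ∀ z, deriv φ z = deriv φ 0 := fun z => is_const_of_deriv_eq_zero h2 h0 z 0
  refine ⟨deriv φ 0, φ 0 - deriv φ 0 * 0, fun z => ?_⟩
  have hl : Differentiable ℝ fun y : ℝ => deriv φ 0 * y := differentiable_fun_id.const_mul _
  have hd : Differentiable ℝ fun y => φ y - deriv φ 0 * y := h1.sub hl
  have hconst := is_const_of_deriv_eq_zero hd (fun y => by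
    rw [deriv_fun_sub (h1 y) (hl y), deriv_const_mul_field, deriv_id'', ha y]
    ring) z 0
  linarith

/-- The linear Euler-type equation `c g + γ R g' = 0` on the half-line `R < 0` (`γ ≠ 0`):
every solution is `g(R) = κ (−R)^{−c/γ}` (integrating factor `(−R)^{c/γ}`). For
`c = 1 − γ/2` the exponent is `1/2 − 1/γ = (γ − 2)/(2γ)` (Sperone's Case (B)).
[cite: Sperone2017, §3 proof of Prop. 3.1, Case (B) (arXiv p. 7)] -/
theorem exists_eq_mul_rpow_of_euler_ode_Iio {g : ℝ → ℝ} {c γ : ℝ} (hγ : γ ≠ 0)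
    (hg : DifferentiableOn ℝ g (Iio 0))
    (hode : ∀ R : ℝ, R < 0 → c * g R + γ * R * deriv g R = 0) :
    ∃ κ : ℝ, ∀ R : ℝ, R < 0 → g R = κ * (-R) ^ (-c / γ) := by
  -- integrating factor
  set h : ℝ → ℝ := fun R => g R * (-R) ^ (c / γ) with hh
  have hderiv : ∀ R : ℝ, R < 0 → HasDerivAt h 0 R := by
    intro R hR
    have hR' : 0 < -R := by linarith
    have hgR : HasDerivAt g (deriv g R) R :=
      ((hg R hR).differentiableAt (Iio_mem_nhds hR)).hasDerivAt
    have hpow : HasDerivAt (fun R : ℝ => (-R) ^ (c / γ))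
        ((-1 : ℝ) * (c / γ) * (-R) ^ (c / γ - 1)) R :=
      (hasDerivAt_neg R).rpow_const (Or.inl hR'.ne')
    have hprod := hgR.mul hpow
    have hval : deriv g R * (-R) ^ (c / γ) + g R * ((-1 : ℝ) * (c / γ) * (-R) ^ (c / γ - 1)) = 0 := by
      have e1 : (-R) ^ (c / γ) = (-R) ^ (c / γ - 1) * (-R) := by
        rw [Real.rpow_sub_one hR'.ne', div_mul_cancel₀ _ hR'.ne']
      rw [e1]
      have hg' : deriv g R * (-R) = (c / γ) * g R := by
        have := hode R hR
        field_simp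
        linear_combination (-1 : ℝ) * this
      have : deriv g R * ((-R) ^ (c / γ - 1) * -R) + g R * (-1 * (c / γ) * (-R) ^ (c / γ - 1)) =
          (-R) ^ (c / γ - 1) * (deriv g R * (-R) - (c / γ) * g R) := by ring
      rw [this, hg', sub_self, mul_zero]
    rw [hval] at hprod
    exact hprod
  have hdiff : DifferentiableOn ℝ h (Iio 0) := fun R hR =>
    (hderiv R hR).differentiableAt.differentiableWithinAt
  have hconst : ∀ R : ℝ, R < 0 → h R = h (-1) := fun R hR =>
    isOpen_Iio.is_const_of_deriv_eq_zero isPreconnected_Iio hdiff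
      (fun y hy => (hderiv y hy).deriv) hR (by norm_num)
  refine ⟨h (-1), fun R hR => ?_⟩
  have hR' : 0 < -R := by linarith
  rw [← hconst R hR, hh]
  simp only
  rw [mul_assoc, ← Real.rpow_add hR', show c / γ + -c / γ = 0 by ring, Real.rpow_zero, mul_one]


/-! ### Calculus of `C¹` profiles on the open left half-plane `{R < 0}` -/

/-- The open left half-plane `𝒟 = {(R, Z) : R < 0}` is open. [folklore] -/
private theorem isOpen_leftHalfPlane : IsOpen {Y : ℝ × ℝ | Y.1 < 0} :=
  isOpen_lt continuous_fst continuous_const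

section SliceCalculus

variable {G : ℝ × ℝ → ℝ} {n : WithTop ℕ∞}

/-- A `Cⁿ` profile (`n ≥ 1`) on the open left half-plane is differentiable at each of its points.
[folklore] -/
private theorem differentiableAt_of_contDiffOn_leftHalfPlane (hG : ContDiffOn ℝ n G {Y : ℝ × ℝ | Y.1 < 0})
    (hn : n ≠ 0) {Y : ℝ × ℝ} (hY : Y.1 < 0) : DifferentiableAt ℝ G Y :=
  (hG.differentiableOn hn).differentiableAt (isOpen_leftHalfPlane.mem_nhds hY)

/-- The `Z`-slice `z ↦ G(R, z)` (`R < 0`) of a `C¹` profile has derivative `∂_Z G(R, z)`.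
[folklore] -/
private theorem hasDerivAt_sliceZ (hG : ContDiffOn ℝ n G {Y : ℝ × ℝ | Y.1 < 0}) (hn : n ≠ 0)
    {R : ℝ} (hR : R < 0) (z : ℝ) :
    HasDerivAt (fun z' => G (R, z')) (derivZ G (R, z)) z := by
  have hd : DifferentiableAt ℝ G (R, z) := differentiableAt_of_contDiffOn_leftHalfPlane hG hn hR
  have hl : HasDerivAt (fun z' : ℝ => ((R, z') : ℝ × ℝ)) ((0 : ℝ), (1 : ℝ)) z :=
    (hasDerivAt_const z R).prodMk (hasDerivAt_id z)
  have h := hd.hasFDerivAt.comp_hasDerivAt z hl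
  rwa [derivZ_apply]

/-- The `R`-slice `r ↦ G(r, Z)` of a `C¹` profile has derivative `∂_R G(R, Z)` at every `R < 0`.
[folklore] -/
private theorem hasDerivAt_sliceR (hG : ContDiffOn ℝ n G {Y : ℝ × ℝ | Y.1 < 0}) (hn : n ≠ 0)
    {R : ℝ} (hR : R < 0) (Z : ℝ) :
    HasDerivAt (fun r => G (r, Z)) (derivR G (R, Z)) R := by
  have hd : DifferentiableAt ℝ G (R, Z) := differentiableAt_of_contDiffOn_leftHalfPlane hG hn hR
  have hl : HasDerivAt (fun r : ℝ => ((r, Z) : ℝ × ℝ)) ((1 : ℝ), (0 : ℝ)) R :=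
    (hasDerivAt_id R).prodMk (hasDerivAt_const R Z)
  have h := hd.hasFDerivAt.comp_hasDerivAt R hl
  rwa [derivR_apply]

/-- A `C¹` profile with `∂_R G ≡ 0` on the left half-plane depends on `Z` only:
`G(R, Z) = G(−1, Z)` for `R < 0`. [cite: ChaeTsai2015, §2 proof of Thm. 1 ("From (24) we have Ψ = Ψ(Z)")] -/
theorem eq_slice_of_derivR_eq_zero (hG : ContDiffOn ℝ n G {Y : ℝ × ℝ | Y.1 < 0}) (hn : n ≠ 0)
    (h0 : ∀ Y : ℝ × ℝ, Y.1 < 0 → derivR G Y = 0) {Y : ℝ × ℝ} (hY : Y.1 < 0) :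
    G Y = G (-1, Y.2) := by
  have hdiff : DifferentiableOn ℝ (fun r => G (r, Y.2)) (Iio 0) := fun _ hr =>
    (hasDerivAt_sliceR hG hn hr Y.2).differentiableAt.differentiableWithinAt
  have hder : (Iio (0 : ℝ)).EqOn (deriv fun r => G (r, Y.2)) 0 := fun r hr => by
    rw [(hasDerivAt_sliceR hG hn hr Y.2).deriv]; exact h0 (r, Y.2) hr
  have := isOpen_Iio.is_const_of_deriv_eq_zero isPreconnected_Iio hdiff hder hY
    (show (-1 : ℝ) ∈ Iio 0 by norm_num)
  simpa using this

/-- If `G(R, Z) = φ(Z)` on the left half-plane then `∂_R G = 0` there. [folklore] -/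
private theorem derivR_eq_zero_of_eq_comp_snd {φ : ℝ → ℝ} (hG : ContDiffOn ℝ n G {Y : ℝ × ℝ | Y.1 < 0})
    (hn : n ≠ 0) (h : ∀ Y : ℝ × ℝ, Y.1 < 0 → G Y = φ Y.2) {Y : ℝ × ℝ} (hY : Y.1 < 0) :
    derivR G Y = 0 := by
  rw [derivR_eq_deriv (differentiableAt_of_contDiffOn_leftHalfPlane hG hn hY)]
  have hev : (fun r => G (r, Y.2)) =ᶠ[𝓝 Y.1] fun _ => φ Y.2 :=
    Filter.eventuallyEq_of_mem (Iio_mem_nhds hY) fun r hr => h (r, Y.2) hr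
  rw [hev.deriv_eq, deriv_const]

/-- If `G(R, Z) = φ(Z)` on the left half-plane then `∂_Z G(R, Z) = φ'(Z)` there. [folklore] -/
private theorem derivZ_eq_deriv_of_eq_comp_snd {φ : ℝ → ℝ} (hG : ContDiffOn ℝ n G {Y : ℝ × ℝ | Y.1 < 0})
    (hn : n ≠ 0) (h : ∀ Y : ℝ × ℝ, Y.1 < 0 → G Y = φ Y.2) {Y : ℝ × ℝ} (hY : Y.1 < 0) :
    derivZ G Y = deriv φ Y.2 := by
  rw [derivZ_eq_deriv (differentiableAt_of_contDiffOn_leftHalfPlane hG hn hY)]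
  have : (fun z => G (Y.1, z)) = φ := funext fun z => h (Y.1, z) hY
  rw [this]

/-- If `G(R, Z) = g(R)` on the left half-plane then `∂_Z G = 0` there. [folklore] -/
private theorem derivZ_eq_zero_of_eq_comp_fst {g : ℝ → ℝ} (hG : ContDiffOn ℝ n G {Y : ℝ × ℝ | Y.1 < 0})
    (hn : n ≠ 0) (h : ∀ Y : ℝ × ℝ, Y.1 < 0 → G Y = g Y.1) {Y : ℝ × ℝ} (hY : Y.1 < 0) :
    derivZ G Y = 0 := by
  rw [derivZ_eq_deriv (differentiableAt_of_contDiffOn_leftHalfPlane hG hn hY)]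
  have : (fun z => G (Y.1, z)) = fun _ => g Y.1 := funext fun z => h (Y.1, z) hY
  rw [this, deriv_const]

/-- If `G(R, Z) = g(R)` on the left half-plane then `∂_R G(R, Z) = g'(R)` there. [folklore] -/
private theorem derivR_eq_deriv_of_eq_comp_fst {g : ℝ → ℝ} (hG : ContDiffOn ℝ n G {Y : ℝ × ℝ | Y.1 < 0})
    (hn : n ≠ 0) (h : ∀ Y : ℝ × ℝ, Y.1 < 0 → G Y = g Y.1) {Y : ℝ × ℝ} (hY : Y.1 < 0) :
    derivR G Y = deriv g Y.1 := by
  rw [derivR_eq_deriv (differentiableAt_of_contDiffOn_leftHalfPlane hG hn hY)]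
  have hev : (fun r => G (r, Y.2)) =ᶠ[𝓝 Y.1] g :=
    Filter.eventuallyEq_of_mem (Iio_mem_nhds hY) fun r hr => h (r, Y.2) hr
  rw [hev.deriv_eq]

/-- The `Z`-slice at `R = −1` of a `C¹` profile is differentiable on `ℝ`, and if `G(R,Z) = g(R)`
the `R`-profile `g` is differentiable on `(−∞, 0)`. [folklore] -/
private theorem differentiable_sliceZ (hG : ContDiffOn ℝ n G {Y : ℝ × ℝ | Y.1 < 0}) (hn : n ≠ 0)
    {R : ℝ} (hR : R < 0) : Differentiable ℝ fun z => G (R, z) := fun z =>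
  (hasDerivAt_sliceZ hG hn hR z).differentiableAt

/-- The `R`-slice of a `C¹` profile is differentiable on `(−∞, 0)`. [folklore] -/
private theorem differentiableOn_sliceR (hG : ContDiffOn ℝ n G {Y : ℝ × ℝ | Y.1 < 0}) (hn : n ≠ 0)
    (Z : ℝ) : DifferentiableOn ℝ (fun r => G (r, Z)) (Iio 0) := fun _ hr =>
  (hasDerivAt_sliceR hG hn hr Z).differentiableAt.differentiableWithinAt

/-- For a `C²` profile, the first partial `∂_Z G` is `C¹` on the left half-plane. [folklore] -/
private theorem contDiffOn_derivZ (hG : ContDiffOn ℝ 2 G {Y : ℝ × ℝ | Y.1 < 0}) :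
    ContDiffOn ℝ 1 (derivZ G) {Y : ℝ × ℝ | Y.1 < 0} := by
  have h1 : ContDiffOn ℝ 1 (fderiv ℝ G) {Y : ℝ × ℝ | Y.1 < 0} :=
    hG.fderiv_of_isOpen isOpen_leftHalfPlane (by norm_num)
  have : derivZ G = fun Y => fderiv ℝ G Y ((0 : ℝ), (1 : ℝ)) := funext fun Y => rfl
  rw [this]
  exact h1.clm_apply contDiffOn_const

/-- For a `C²` profile, the first partial `∂_R G` is `C¹` on the left half-plane. [folklore] -/
private theorem contDiffOn_derivR (hG : ContDiffOn ℝ 2 G {Y : ℝ × ℝ | Y.1 < 0}) :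
    ContDiffOn ℝ 1 (derivR G) {Y : ℝ × ℝ | Y.1 < 0} := by
  have h1 : ContDiffOn ℝ 1 (fderiv ℝ G) {Y : ℝ × ℝ | Y.1 < 0} :=
    hG.fderiv_of_isOpen isOpen_leftHalfPlane (by norm_num)
  have : derivR G = fun Y => fderiv ℝ G Y ((1 : ℝ), (0 : ℝ)) := funext fun Y => rfl
  rw [this]
  exact h1.clm_apply contDiffOn_const

end SliceCalculus

/-! ### Decay `|U(Y)| + |Ω(Y)| = o(1)` along vertical lines -/

section Decay

variable {U Ω : ℝ × ℝ → ℝ}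

/-- Chae–Tsai's decay condition (26), `|U(Y)| + |Ω(Y)| = o(1)` as `|Y| → ∞` in the left
half-plane, restricted to a vertical line `R = const`: `U(R, Z) → 0` as `Z → +∞`.
[cite: ChaeTsai2015, §2 Thm. 1, condition (26)] -/
theorem tendsto_sliceZ_atTop_of_decay
    (h : ∀ ε : ℝ, 0 < ε → ∃ M : ℝ, ∀ Y : ℝ × ℝ, Y.1 < 0 → M ≤ ‖Y‖ → |U Y| + |Ω Y| < ε)
    {R : ℝ} (hR : R < 0) :
    Tendsto (fun z => U (R, z)) atTop (𝓝 0) ∧ Tendsto (fun z => Ω (R, z)) atTop (𝓝 0) := by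
  constructor <;>
  · refine Metric.tendsto_atTop.2 fun ε hε => ?_
    obtain ⟨M, hM⟩ := h ε hε
    refine ⟨max M 0, fun z hz => ?_⟩
    have hz0 : 0 ≤ z := le_trans (le_max_right _ _) hz
    have hnorm : M ≤ ‖((R, z) : ℝ × ℝ)‖ := by
      refine le_trans (le_max_left _ _) (le_trans hz ?_)
      rw [Prod.norm_def]
      exact le_trans (le_abs_self z) (le_max_right _ _)
    have := hM (R, z) hR hnorm
    rw [Real.dist_eq, sub_zero]
    have h1 := abs_nonneg (U (R, z))
    have h2 := abs_nonneg (Ω (R, z))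
    linarith

/-- The same decay as `Z → −∞`. [cite: ChaeTsai2015, §2 Thm. 1, condition (26)] -/
theorem tendsto_sliceZ_atBot_of_decay
    (h : ∀ ε : ℝ, 0 < ε → ∃ M : ℝ, ∀ Y : ℝ × ℝ, Y.1 < 0 → M ≤ ‖Y‖ → |U Y| + |Ω Y| < ε)
    {R : ℝ} (hR : R < 0) :
    Tendsto (fun z => U (R, z)) atBot (𝓝 0) ∧ Tendsto (fun z => Ω (R, z)) atBot (𝓝 0) := by
  constructor <;>
  · refine Metric.tendsto_nhds.2 fun ε hε => eventually_atBot.2 ?_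
    obtain ⟨M, hM⟩ := h ε hε
    refine ⟨-max M 0, fun z hz => ?_⟩
    have hnorm : M ≤ ‖((R, z) : ℝ × ℝ)‖ := by
      have hz' : max M 0 ≤ -z := by linarith
      refine le_trans (le_max_left M 0) (le_trans hz' ?_)
      rw [Prod.norm_def]
      exact le_trans (neg_le_abs z) (le_max_right _ _)
    have := hM (R, z) hR hnorm
    rw [Real.dist_eq, sub_zero]
    have h1 := abs_nonneg (U (R, z))
    have h2 := abs_nonneg (Ω (R, z))
    linarith

end Decay


/-! ### The reduced profile system: common first steps -/

section Core

variable {γ : ℝ} {U Ω Ψ : ℝ × ℝ → ℝ}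

/-- From (24) `∂_R Ψ = 0`: `Ψ = Ψ(Z)` on the left half-plane, with the derivative dictionary
`∂_Z Ψ = φ'`, `∂_R∂_R Ψ = 0`, `∂_Z∂_Z Ψ = φ''` for the `C²` function `φ(Z) = Ψ(−1, Z)`.
[cite: ChaeTsai2015, §2 proof of Thm. 1 ("From (24) we have Ψ = Ψ(Z) on 𝒟")] -/
theorem stream_reduce (hΨ : ContDiffOn ℝ 2 Ψ {Y : ℝ × ℝ | Y.1 < 0})
    (h24 : ∀ Y : ℝ × ℝ, Y.1 < 0 → derivR Ψ Y = 0) :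
    (∀ Y : ℝ × ℝ, Y.1 < 0 → Ψ Y = Ψ (-1, Y.2)) ∧
    (∀ Y : ℝ × ℝ, Y.1 < 0 → derivZ Ψ Y = deriv (fun z => Ψ (-1, z)) Y.2) ∧
    (∀ Y : ℝ × ℝ, Y.1 < 0 → derivR (derivR Ψ) Y = 0) ∧
    (∀ Y : ℝ × ℝ, Y.1 < 0 → derivZ (derivZ Ψ) Y = deriv (deriv fun z => Ψ (-1, z)) Y.2) ∧
    Differentiable ℝ (fun z => Ψ (-1, z)) ∧ Differentiable ℝ (deriv fun z => Ψ (-1, z)) := by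
  have hΨeq : ∀ Y : ℝ × ℝ, Y.1 < 0 → Ψ Y = Ψ (-1, Y.2) := fun Y hY =>
    eq_slice_of_derivR_eq_zero hΨ two_ne_zero h24 hY
  have hΨZ : ∀ Y : ℝ × ℝ, Y.1 < 0 → derivZ Ψ Y = deriv (fun z => Ψ (-1, z)) Y.2 := fun Y hY =>
    derivZ_eq_deriv_of_eq_comp_snd hΨ two_ne_zero hΨeq hY
  have hdφ : deriv (fun z => Ψ (-1, z)) = fun z => derivZ Ψ (-1, z) :=
    funext fun z => (hasDerivAt_sliceZ hΨ two_ne_zero (by norm_num : (-1 : ℝ) < 0) z).deriv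
  have hdZ1 : ContDiffOn ℝ 1 (derivZ Ψ) {Y : ℝ × ℝ | Y.1 < 0} := contDiffOn_derivZ hΨ
  refine ⟨hΨeq, hΨZ, fun Y hY => ?_, fun Y hY => ?_,
    differentiable_sliceZ hΨ two_ne_zero (by norm_num), ?_⟩
  · -- `∂_R ∂_R Ψ = 0`: `∂_R Ψ` vanishes on a neighbourhood of `Y`
    have hev : derivR Ψ =ᶠ[𝓝 Y] fun _ => (0 : ℝ) :=
      Filter.eventuallyEq_of_mem (isOpen_leftHalfPlane.mem_nhds hY) fun Y' hY' => h24 Y' hY'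
    rw [derivR_apply, hev.fderiv_eq]
    simp
  · rw [derivZ_eq_deriv_of_eq_comp_snd hdZ1 one_ne_zero (fun Y' hY' => hΨZ Y' hY') hY, hdφ]
  · rw [hdφ]
    exact differentiable_sliceZ hdZ1 one_ne_zero (by norm_num)

/-- From (21) `−ΔΨ = Ω` and `Ψ = Ψ(Z)`: `Ω = Ω(Z) = −φ''(Z)`, with `∂_R Ω = 0`, `∂_Z Ω = w'`,
`w(Z) = Ω(−1, Z)` differentiable. [cite: ChaeTsai2015, §2 proof of Thm. 1 ("From this and (21) we also have Ω = Ω(Z)")] -/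
theorem vorticity_reduce (hΩ : ContDiffOn ℝ 1 Ω {Y : ℝ × ℝ | Y.1 < 0})
    (hΨ : ContDiffOn ℝ 2 Ψ {Y : ℝ × ℝ | Y.1 < 0})
    (h21 : ∀ Y : ℝ × ℝ, Y.1 < 0 → -(derivR (derivR Ψ) Y + derivZ (derivZ Ψ) Y) = Ω Y)
    (h24 : ∀ Y : ℝ × ℝ, Y.1 < 0 → derivR Ψ Y = 0) :
    (∀ Y : ℝ × ℝ, Y.1 < 0 → Ω Y = Ω (-1, Y.2)) ∧
    (∀ z : ℝ, Ω (-1, z) = -deriv (deriv fun z => Ψ (-1, z)) z) ∧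
    (∀ Y : ℝ × ℝ, Y.1 < 0 → derivR Ω Y = 0) ∧
    (∀ Y : ℝ × ℝ, Y.1 < 0 → derivZ Ω Y = deriv (fun z => Ω (-1, z)) Y.2) ∧
    Differentiable ℝ (fun z => Ω (-1, z)) := by
  obtain ⟨-, -, hRR, hZZ, -, -⟩ := stream_reduce hΨ h24
  have hw : ∀ z : ℝ, Ω (-1, z) = -deriv (deriv fun z => Ψ (-1, z)) z := by
    intro z
    have h := h21 (-1, z) (by norm_num)
    rw [hRR (-1, z) (by norm_num), hZZ (-1, z) (by norm_num), zero_add] at h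
    exact h.symm
  have hΩeq : ∀ Y : ℝ × ℝ, Y.1 < 0 → Ω Y = Ω (-1, Y.2) := by
    intro Y hY
    have h := h21 Y hY
    rw [hRR Y hY, hZZ Y hY, zero_add] at h
    rw [← h, hw]
  exact ⟨hΩeq, hw,
    fun Y hY => derivR_eq_zero_of_eq_comp_snd (φ := fun z => Ω (-1, z)) hΩ one_ne_zero hΩeq hY,
    fun Y hY => derivZ_eq_deriv_of_eq_comp_snd (φ := fun z => Ω (-1, z)) hΩ one_ne_zero hΩeq hY,
    differentiable_sliceZ hΩ one_ne_zero (by norm_num)⟩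

/-- The `Z`-derivative of `U²` along a vertical line is the slice derivative. [folklore] -/
private theorem derivZ_sq_eq (hU : ContDiffOn ℝ 1 U {Y : ℝ × ℝ | Y.1 < 0}) {Y : ℝ × ℝ} (hY : Y.1 < 0) :
    derivZ (fun Y' => U Y' ^ 2) Y = deriv (fun z => U (Y.1, z) ^ 2) Y.2 :=
  derivZ_eq_deriv (differentiableAt_of_contDiffOn_leftHalfPlane (hU.pow 2) one_ne_zero hY)

/-- If `∂_Z(U²)(R, Z) = h(Z)` is independent of `R`, then `U(R, Z)² − U(R', Z)²` is independent of
`Z`. [cite: ChaeTsai2015, §2 proof of Thm. 1 ("we have U²(Y) = f(Z) + g(R)")] -/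
theorem sq_sub_sq_const_of_derivZ (hU : ContDiffOn ℝ 1 U {Y : ℝ × ℝ | Y.1 < 0}) {h : ℝ → ℝ}
    (hd : ∀ Y : ℝ × ℝ, Y.1 < 0 → derivZ (fun Y' => U Y' ^ 2) Y = h Y.2)
    {R R' : ℝ} (hR : R < 0) (hR' : R' < 0) (z z' : ℝ) :
    U (R, z) ^ 2 - U (R', z) ^ 2 = U (R, z') ^ 2 - U (R', z') ^ 2 := by
  have hdR : ∀ {R : ℝ}, R < 0 → ∀ z, HasDerivAt (fun z => U (R, z) ^ 2) (h z) z := by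
    intro R hR z
    have h1 := (hasDerivAt_sliceZ hU one_ne_zero hR z).fun_pow 2
    have h2 : deriv (fun z => U (R, z) ^ 2) z = h z := by
      rw [← derivZ_sq_eq hU (Y := (R, z)) hR]; exact hd (R, z) hR
    rw [← h2]
    exact h1.differentiableAt.hasDerivAt
  have hF : Differentiable ℝ fun z => U (R, z) ^ 2 - U (R', z) ^ 2 := fun z =>
    ((hdR hR z).fun_sub (hdR hR' z)).differentiableAt
  exact is_const_of_deriv_eq_zero hF (fun z => by
    rw [((hdR hR z).fun_sub (hdR hR' z)).deriv]; ring) z z'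

/-! ### Chae–Tsai 2015, Theorem 1 at the level of the profiles -/

/-- **Chae–Tsai 2015, Theorem 1 — the over-determined profile system has only the trivial
decaying solution.** Let `U, Ω ∈ C¹` and `Ψ ∈ C²` on the open left half-plane
`𝒟 = {(R, Z) : R < 0}` satisfy the leading-order Luo–Hou profile system
(19) `(1 − γ/2)U + γ Y·∇U + ∇⊥Ψ·∇U = 0`, (20) `Ω + γ Y·∇Ω + ∇⊥Ψ·∇Ω = ∂_Z(U²)`,
(21) `−ΔΨ = Ω` together with the next-order equation (24) `∂_R Ψ = 0`
(`∇ = (∂_R, ∂_Z)`, `∇⊥ = (−∂_Z, ∂_R)`, `γ > 0`), and the decay (26)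
`|U(Y)| + |Ω(Y)| → 0` as `|Y| → ∞` in `𝒟`. Then `U = Ω = 0` and `Ψ = aZ + b` on `𝒟`.
(Proof as printed: `Ψ = Ψ(Z)`, `Ω = Ω(Z)`, `U² = f(Z) + g(R)` with `g` constant by decay,
`U = U(Z)`, then the maximum principle for `(1 − γ/2)U + γZU' = 0` and `Ω + γZΩ' = 0`.)
[cite: ChaeTsai2015, §2 Thm. 1 and its proof (J. Nonlinear Sci. 25 (2015) 193; arXiv:1402.4560 pp. 4–5)] -/
theorem profile_trivial_of_decay (hγ : 0 < γ)
    (hU : ContDiffOn ℝ 1 U {Y : ℝ × ℝ | Y.1 < 0}) (hΩ : ContDiffOn ℝ 1 Ω {Y : ℝ × ℝ | Y.1 < 0})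
    (hΨ : ContDiffOn ℝ 2 Ψ {Y : ℝ × ℝ | Y.1 < 0})
    (h19 : ∀ Y : ℝ × ℝ, Y.1 < 0 →
      (1 - γ / 2) * U Y + γ * (Y.1 * derivR U Y + Y.2 * derivZ U Y) +
        (-derivZ Ψ Y * derivR U Y + derivR Ψ Y * derivZ U Y) = 0)
    (h20 : ∀ Y : ℝ × ℝ, Y.1 < 0 →
      Ω Y + γ * (Y.1 * derivR Ω Y + Y.2 * derivZ Ω Y) +
        (-derivZ Ψ Y * derivR Ω Y + derivR Ψ Y * derivZ Ω Y) = derivZ (fun Y' => U Y' ^ 2) Y)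
    (h21 : ∀ Y : ℝ × ℝ, Y.1 < 0 → -(derivR (derivR Ψ) Y + derivZ (derivZ Ψ) Y) = Ω Y)
    (h24 : ∀ Y : ℝ × ℝ, Y.1 < 0 → derivR Ψ Y = 0)
    (hdecay : ∀ ε : ℝ, 0 < ε → ∃ M : ℝ, ∀ Y : ℝ × ℝ, Y.1 < 0 → M ≤ ‖Y‖ → |U Y| + |Ω Y| < ε) :
    (∀ Y : ℝ × ℝ, Y.1 < 0 → U Y = 0 ∧ Ω Y = 0) ∧
      ∃ a b : ℝ, ∀ Y : ℝ × ℝ, Y.1 < 0 → Ψ Y = a * Y.2 + b := by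
  obtain ⟨hΨeq, hΨZ, hΨRR, hΨZZ, hφ1, hφ2⟩ := stream_reduce hΨ h24
  obtain ⟨hΩeq, hw, hΩR, hΩZ, hw1⟩ := vorticity_reduce hΩ hΨ h21 h24
  set φ : ℝ → ℝ := fun z => Ψ (-1, z) with hφ
  set w : ℝ → ℝ := fun z => Ω (-1, z) with hwdef
  -- (20) ⇒ `∂_Z(U²)(R, Z) = w(Z) + γ Z w'(Z)`
  have hd20 : ∀ Y : ℝ × ℝ, Y.1 < 0 →
      derivZ (fun Y' => U Y' ^ 2) Y = w Y.2 + γ * Y.2 * deriv w Y.2 := by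
    intro Y hY
    have h := h20 Y hY
    rw [hΩR Y hY, hΩZ Y hY, h24 Y hY, hΩeq Y hY] at h
    rw [← h]; ring
  -- `U(R,Z)² = U(−1,Z)²`: the difference is constant in `Z` and tends to `0`
  have hsq : ∀ R : ℝ, R < 0 → ∀ z : ℝ, U (R, z) ^ 2 = U (-1, z) ^ 2 := by
    intro R hR z
    have hconst := fun z' => sq_sub_sq_const_of_derivZ hU
      (h := fun z => w z + γ * z * deriv w z) hd20 hR (by norm_num : (-1:ℝ) < 0) z z'
    have hlimR := (tendsto_sliceZ_atTop_of_decay hdecay hR).1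
    have hlim1 := (tendsto_sliceZ_atTop_of_decay hdecay (by norm_num : (-1:ℝ) < 0)).1
    have hlim : Tendsto (fun z' => U (R, z') ^ 2 - U (-1, z') ^ 2) atTop (𝓝 0) := by
      have := (hlimR.pow 2).sub (hlim1.pow 2)
      simpa using this
    have hc : Tendsto (fun _ : ℝ => U (R, z) ^ 2 - U (-1, z) ^ 2) atTop (𝓝 0) :=
      hlim.congr' (Eventually.of_forall fun z' => (hconst z').symm)
    have := tendsto_nhds_unique hc tendsto_const_nhds
    linarith
  -- hence `U = U(Z)` (sign rigidity along `R`)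
  have hUeq : ∀ Y : ℝ × ℝ, Y.1 < 0 → U Y = U (-1, Y.2) := by
    intro Y hY
    have hcont : ContinuousOn (fun r => U (r, Y.2)) (Iio 0) :=
      (differentiableOn_sliceR hU one_ne_zero Y.2).continuousOn
    have := eq_of_sq_eq_sq_of_continuousOn isPreconnected_Iio hcont
      (show (-1 : ℝ) ∈ Iio 0 by norm_num) (fun r hr => hsq r hr Y.2) hY
    simpa using this
  set v : ℝ → ℝ := fun z => U (-1, z) with hv
  have hv1 : Differentiable ℝ v := differentiable_sliceZ hU one_ne_zero (by norm_num)
  have hUR : ∀ Y : ℝ × ℝ, Y.1 < 0 → derivR U Y = 0 := fun Y hY =>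
    derivR_eq_zero_of_eq_comp_snd (φ := v) hU one_ne_zero hUeq hY
  have hUZ : ∀ Y : ℝ × ℝ, Y.1 < 0 → derivZ U Y = deriv v Y.2 := fun Y hY =>
    derivZ_eq_deriv_of_eq_comp_snd (φ := v) hU one_ne_zero hUeq hY
  -- (19) ⇒ `(1 − γ/2) v + γ Z v' = 0`, and `v → 0` at `±∞`, so `v = 0`
  have hvode : ∀ z, (1 - γ / 2) * v z + γ * z * deriv v z = 0 := by
    intro z
    have h := h19 (-1, z) (by norm_num)
    rw [hUR _ (by norm_num), hUZ _ (by norm_num), h24 _ (by norm_num)] at h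
    simp only at h
    linear_combination h
  have hvtop := (tendsto_sliceZ_atTop_of_decay hdecay (by norm_num : (-1:ℝ) < 0)).1
  have hvbot := (tendsto_sliceZ_atBot_of_decay hdecay (by norm_num : (-1:ℝ) < 0)).1
  have hv0 : ∀ z, v z = 0 := eq_zero_of_euler_ode hγ hv1 hvode hvtop hvbot
  have hU0 : ∀ Y : ℝ × ℝ, Y.1 < 0 → U Y = 0 := fun Y hY => by rw [hUeq Y hY]; exact hv0 Y.2
  -- (20) with `U = 0` ⇒ `w + γ Z w' = 0`, and `w → 0`, so `w = 0`
  have hwode : ∀ z, (1 : ℝ) * w z + γ * z * deriv w z = 0 := by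
    intro z
    have h := hd20 (-1, z) (by norm_num)
    rw [derivZ_sq_eq hU (by norm_num)] at h
    have h0 : (fun z' => U (((-1 : ℝ), z).1, z') ^ 2) = fun _ => (0 : ℝ) :=
      funext fun z' => by rw [hU0 _ (by norm_num)]; ring
    rw [h0, deriv_const] at h
    simp only at h
    linarith
  have hwtop := (tendsto_sliceZ_atTop_of_decay hdecay (by norm_num : (-1:ℝ) < 0)).2
  have hwbot := (tendsto_sliceZ_atBot_of_decay hdecay (by norm_num : (-1:ℝ) < 0)).2
  have hw0 : ∀ z, w z = 0 := eq_zero_of_euler_ode hγ hw1 hwode hwtop hwbot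
  have hΩ0 : ∀ Y : ℝ × ℝ, Y.1 < 0 → Ω Y = 0 := fun Y hY => by rw [hΩeq Y hY]; exact hw0 Y.2
  -- `φ'' = −w = 0` ⇒ `φ` affine
  have hφ0 : ∀ z, deriv (deriv φ) z = 0 := fun z => by
    have h1 := hw z
    have h2 : Ω (-1, z) = 0 := hw0 z
    linarith
  obtain ⟨a, b, hab⟩ := exists_affine_of_deriv_deriv_eq_zero hφ1 hφ2 hφ0
  exact ⟨fun Y hY => ⟨hU0 Y hY, hΩ0 Y hY⟩, a, b, fun Y hY => by rw [hΨeq Y hY]; exact hab Y.2⟩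


/-! ### Sperone 2017, Proposition 3.1 at the level of the profiles -/

/-- **Sperone 2017, Proposition 3.1 — classification of ALL solutions of the over-determined
profile system (no decay assumed).** Let `U, Ω ∈ C¹`, `Ψ ∈ C²` on the open left half-plane
`𝒟 = {R < 0}` satisfy the six equations (19)–(24) produced by Luo–Hou's ansatz:
(19) `(1 − γ/2)U + γY·∇U + ∇⊥Ψ·∇U = 0`, (20) `Ω + γY·∇Ω + ∇⊥Ψ·∇Ω = ∂_Z(U²)`, (21) `−ΔΨ = Ω`,
(22) `R(∇⊥Ψ·∇U) + 2Ψ ∂_Z U = 2U ∂_Z Ψ`, (23) `R(∇⊥Ψ·∇Ω) + 2Ψ ∂_Z Ω = 0`, (24) `∂_R Ψ = 0`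
(`γ > 0`). Then EITHER `U = Ω = 0`, `Ψ = bZ + c` (the zero-vorticity family (3.7)), OR `Ω = 0`,
`Ψ = c` and `U(R, Z) = κ(−R)^{1/2 − 1/γ}` (the stationary singular swirl (3.8),
`u₁ = κ(1 − r)^{(γ−2)/(2γ)}`). Proof as printed (`Ψ = φ(Z)`, `Ω = −φ''`, (23) gives `φ·Ω' = 0`
hence `Ω ≡ a`, `φ` quadratic; then `a = 0`; then (20) makes `U = U(R)` and (19), (22) become the
ODE pair (3.25)), except that the case `a ≠ 0` is dismissed here by the shorter remark that (20)
would force `U(R, Z)² = U(R, 0)² + aZ < 0` for suitable `Z` (print divides (3.16) by `Z → +∞`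
and (3.20) by `R → −∞` instead).
[cite: Sperone2017, §3 Prop. 3.1 and its proof (J. Nonlinear Sci. 27 (2017) 1325; arXiv:1708.09648 pp. 4–8)] -/
theorem profile_classification (hγ : 0 < γ)
    (hU : ContDiffOn ℝ 1 U {Y : ℝ × ℝ | Y.1 < 0}) (hΩ : ContDiffOn ℝ 1 Ω {Y : ℝ × ℝ | Y.1 < 0})
    (hΨ : ContDiffOn ℝ 2 Ψ {Y : ℝ × ℝ | Y.1 < 0})
    (h19 : ∀ Y : ℝ × ℝ, Y.1 < 0 →
      (1 - γ / 2) * U Y + γ * (Y.1 * derivR U Y + Y.2 * derivZ U Y) +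
        (-derivZ Ψ Y * derivR U Y + derivR Ψ Y * derivZ U Y) = 0)
    (h20 : ∀ Y : ℝ × ℝ, Y.1 < 0 →
      Ω Y + γ * (Y.1 * derivR Ω Y + Y.2 * derivZ Ω Y) +
        (-derivZ Ψ Y * derivR Ω Y + derivR Ψ Y * derivZ Ω Y) = derivZ (fun Y' => U Y' ^ 2) Y)
    (h21 : ∀ Y : ℝ × ℝ, Y.1 < 0 → -(derivR (derivR Ψ) Y + derivZ (derivZ Ψ) Y) = Ω Y)
    (h22 : ∀ Y : ℝ × ℝ, Y.1 < 0 →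
      Y.1 * (-derivZ Ψ Y * derivR U Y + derivR Ψ Y * derivZ U Y) + 2 * Ψ Y * derivZ U Y =
        2 * U Y * derivZ Ψ Y)
    (h23 : ∀ Y : ℝ × ℝ, Y.1 < 0 →
      Y.1 * (-derivZ Ψ Y * derivR Ω Y + derivR Ψ Y * derivZ Ω Y) + 2 * Ψ Y * derivZ Ω Y = 0)
    (h24 : ∀ Y : ℝ × ℝ, Y.1 < 0 → derivR Ψ Y = 0) :
    (∃ b c : ℝ, ∀ Y : ℝ × ℝ, Y.1 < 0 → U Y = 0 ∧ Ω Y = 0 ∧ Ψ Y = b * Y.2 + c) ∨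
    (∃ κ c : ℝ, ∀ Y : ℝ × ℝ, Y.1 < 0 →
      U Y = κ * (-Y.1) ^ (1 / 2 - 1 / γ) ∧ Ω Y = 0 ∧ Ψ Y = c) := by
  obtain ⟨hΨeq, hΨZ, hΨRR, hΨZZ, hφ1, hφ2⟩ := stream_reduce hΨ h24
  obtain ⟨hΩeq, hw, hΩR, hΩZ, hw1⟩ := vorticity_reduce hΩ hΨ h21 h24
  set φ : ℝ → ℝ := fun z => Ψ (-1, z) with hφ
  set w : ℝ → ℝ := fun z => Ω (-1, z) with hwdef
  have hw' : ∀ z, w z = -deriv (deriv φ) z := hw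
  -- (23) ⇒ `φ · w' = 0`
  have h23' : ∀ z : ℝ, φ z * deriv w z = 0 := by
    intro z
    have h := h23 (-1, z) (by norm_num)
    rw [hΩR _ (by norm_num), hΩZ _ (by norm_num), h24 _ (by norm_num), hΨeq _ (by norm_num)] at h
    simp only at h
    linear_combination (1 / 2 : ℝ) * h
  -- `w'` is continuous (`w = Ω(−1, ·)`, `Ω ∈ C¹`)
  have hdw : deriv w = fun z => derivZ Ω (-1, z) :=
    funext fun z => (hasDerivAt_sliceZ hΩ one_ne_zero (by norm_num : (-1 : ℝ) < 0) z).deriv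
  have hw'cont : Continuous (deriv w) := by
    rw [hdw]
    have hc : ContinuousOn (derivZ Ω) {Y : ℝ × ℝ | Y.1 < 0} := by
      have := hΩ.continuousOn_fderiv_of_isOpen isOpen_leftHalfPlane le_rfl
      have e : derivZ Ω = fun Y => fderiv ℝ Ω Y ((0 : ℝ), (1 : ℝ)) := funext fun Y => rfl
      rw [e]
      exact this.clm_apply continuousOn_const
    have hemb : Continuous fun z : ℝ => ((-1 : ℝ), z) := continuous_const.prodMk continuous_id
    exact hc.comp_continuous hemb fun z => by norm_num
  -- `w' ≡ 0`: otherwise `φ = 0` near a point where `w' ≠ 0`, hence `w = −φ'' = 0` there too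
  have hw'0 : ∀ z, deriv w z = 0 := by
    by_contra! hcon
    obtain ⟨z₀, hz₀⟩ := hcon
    set N : Set ℝ := {z | deriv w z ≠ 0} with hN
    have hNopen : IsOpen N := isOpen_ne_fun hw'cont continuous_const
    have hφN : ∀ z ∈ N, φ z = 0 := fun z hz =>
      (mul_eq_zero.1 (h23' z)).resolve_right hz
    have hwN : ∀ z ∈ N, w z = 0 := by
      intro z hz
      have hev : φ =ᶠ[𝓝 z] fun _ => (0 : ℝ) :=
        Filter.eventuallyEq_of_mem (hNopen.mem_nhds hz) hφN
      have h1 : deriv φ =ᶠ[𝓝 z] deriv (fun _ : ℝ => (0 : ℝ)) := hev.deriv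
      have h2 : deriv (deriv φ) z = 0 := by
        rw [h1.deriv_eq]; simp
      rw [hw' z, h2, neg_zero]
    have hev : w =ᶠ[𝓝 z₀] fun _ => (0 : ℝ) :=
      Filter.eventuallyEq_of_mem (hNopen.mem_nhds hz₀) hwN
    have : deriv w z₀ = 0 := by rw [hev.deriv_eq, deriv_const]
    exact hz₀ this
  -- `w ≡ a`
  have hwa : ∀ z, w z = w 0 := fun z => is_const_of_deriv_eq_zero hw1 hw'0 z 0
  set a : ℝ := w 0 with ha
  -- (20) ⇒ `∂_Z(U²) = a`; `a ≠ 0` is impossible (`U² ≥ 0`)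
  have hd20 : ∀ Y : ℝ × ℝ, Y.1 < 0 → derivZ (fun Y' => U Y' ^ 2) Y = a := by
    intro Y hY
    have h := h20 Y hY
    rw [hΩR Y hY, hΩZ Y hY, h24 Y hY, hΩeq Y hY, hw'0] at h
    rw [← h]
    show w Y.2 + γ * (Y.1 * 0 + Y.2 * 0) + (-derivZ Ψ Y * 0 + 0 * 0) = a
    rw [hwa Y.2]; ring
  have hsqZ : ∀ R : ℝ, R < 0 → ∀ z : ℝ, U (R, z) ^ 2 = U (R, 0) ^ 2 + a * z := by
    intro R hR z
    have hdR : ∀ z, HasDerivAt (fun z => U (R, z) ^ 2 - a * z) 0 z := by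
      intro z
      have h1 := (hasDerivAt_sliceZ hU one_ne_zero hR z).fun_pow 2
      have h2 : deriv (fun z => U (R, z) ^ 2) z = a := by
        rw [← derivZ_sq_eq hU (Y := (R, z)) hR]; exact hd20 (R, z) hR
      have h3 : HasDerivAt (fun z => U (R, z) ^ 2) a z := by
        rw [← h2]; exact h1.differentiableAt.hasDerivAt
      have h4 : HasDerivAt (fun z : ℝ => a * z) a z := by
        simpa using (hasDerivAt_id z).const_mul a
      have := h3.fun_sub h4
      rwa [sub_self] at this
    have hF : Differentiable ℝ fun z => U (R, z) ^ 2 - a * z := fun z => (hdR z).differentiableAt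
    have := is_const_of_deriv_eq_zero hF (fun z => (hdR z).deriv) z 0
    simp only [mul_zero, sub_zero] at this
    linarith
  have ha0 : a = 0 := by
    by_contra ha0
    have h := hsqZ (-1) (by norm_num) (-(U (-1, 0) ^ 2 + 1) / a)
    have e : a * (-(U (-1, 0) ^ 2 + 1) / a) = -(U (-1, 0) ^ 2 + 1) := by field_simp
    rw [e] at h
    nlinarith [sq_nonneg (U (-1, -(U (-1, 0) ^ 2 + 1) / a))]
  -- hence `Ω = 0`, `φ'' = 0`, `φ = bZ + c`
  have hΩ0 : ∀ Y : ℝ × ℝ, Y.1 < 0 → Ω Y = 0 := fun Y hY => by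
    rw [hΩeq Y hY]; show w Y.2 = 0; rw [hwa Y.2]; exact ha0
  have hφ0 : ∀ z, deriv (deriv φ) z = 0 := fun z => by
    have h1 := hw' z
    have h2 : w z = 0 := by rw [hwa z]; exact ha0
    linarith
  obtain ⟨b, c, hbc⟩ := exists_affine_of_deriv_deriv_eq_zero hφ1 hφ2 hφ0
  have hΨbc : ∀ Y : ℝ × ℝ, Y.1 < 0 → Ψ Y = b * Y.2 + c := fun Y hY => by
    rw [hΨeq Y hY]; exact hbc Y.2
  have hφ' : ∀ z, deriv φ z = b := by
    have : φ = fun z => b * z + c := funext hbc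
    intro z; rw [this]
    rw [deriv_add_const, deriv_const_mul_field, deriv_id'', mul_one]
  have hΨZb : ∀ Y : ℝ × ℝ, Y.1 < 0 → derivZ Ψ Y = b := fun Y hY => by rw [hΨZ Y hY, hφ' Y.2]
  -- (20) now reads `∂_Z(U²) = 0`: `U = U(R)`
  have hsqZ' : ∀ R : ℝ, R < 0 → ∀ z : ℝ, U (R, z) ^ 2 = U (R, 0) ^ 2 := fun R hR z => by
    rw [hsqZ R hR z, ha0]; ring
  have hUeq : ∀ Y : ℝ × ℝ, Y.1 < 0 → U Y = U (Y.1, 0) := by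
    intro Y hY
    have hcont : ContinuousOn (fun z => U (Y.1, z)) univ :=
      (differentiable_sliceZ hU one_ne_zero hY).continuous.continuousOn
    exact eq_of_sq_eq_sq_of_continuousOn isPreconnected_univ hcont (mem_univ 0)
      (fun z _ => hsqZ' Y.1 hY z) (mem_univ Y.2)
  set g : ℝ → ℝ := fun r => U (r, 0) with hg
  have hg1 : DifferentiableOn ℝ g (Iio 0) := differentiableOn_sliceR hU one_ne_zero 0
  have hUZ0 : ∀ Y : ℝ × ℝ, Y.1 < 0 → derivZ U Y = 0 := fun Y hY =>
    derivZ_eq_zero_of_eq_comp_fst (g := g) hU one_ne_zero hUeq hY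
  have hURg : ∀ Y : ℝ × ℝ, Y.1 < 0 → derivR U Y = deriv g Y.1 := fun Y hY =>
    derivR_eq_deriv_of_eq_comp_fst (g := g) hU one_ne_zero hUeq hY
  -- (19) and (22) become the ODE pair (3.25)
  have e19 : ∀ R : ℝ, R < 0 → (1 - γ / 2) * g R + γ * R * deriv g R - b * deriv g R = 0 := by
    intro R hR
    have h := h19 (R, 0) hR
    rw [hURg _ hR, hUZ0 _ hR, h24 _ hR, hΨZb _ hR, hUeq _ hR] at h
    simp only at h
    linear_combination h
  have e22 : ∀ R : ℝ, R < 0 → -(b * R * deriv g R) = 2 * b * g R := by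
    intro R hR
    have h := h22 (R, 0) hR
    rw [hURg _ hR, hUZ0 _ hR, h24 _ hR, hΨZb _ hR, hUeq _ hR] at h
    simp only at h
    linear_combination h
  by_cases hb : b = 0
  · -- Case (B): `Ψ = c`, `(1 − γ/2) g + γ R g' = 0` ⇒ `g = κ (−R)^{1/2 − 1/γ}`
    right
    have hode : ∀ R : ℝ, R < 0 → (1 - γ / 2) * g R + γ * R * deriv g R = 0 := fun R hR => by
      have := e19 R hR; rw [hb] at this; linarith
    obtain ⟨κ, hκ⟩ := exists_eq_mul_rpow_of_euler_ode_Iio hγ.ne' hg1 hode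
    have hexp : -(1 - γ / 2) / γ = 1 / 2 - 1 / γ := by field_simp; ring
    refine ⟨κ, c, fun Y hY => ⟨?_, hΩ0 Y hY, ?_⟩⟩
    · rw [hUeq Y hY, ← hexp]; exact hκ Y.1 hY
    · rw [hΨbc Y hY, hb]; ring
  · -- Case (A): `b ≠ 0` ⇒ `g ≡ 0`
    left
    refine ⟨b, c, fun Y hY => ⟨?_, hΩ0 Y hY, hΨbc Y hY⟩⟩
    -- `g R · ((1 − 5γ/2) R + 2b) = 0` on `R < 0`
    have hprod : ∀ R : ℝ, R < 0 → g R * ((1 - 5 * γ / 2) * R + 2 * b) = 0 := by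
      intro R hR
      have h1 := e19 R hR
      have h2 := e22 R hR
      -- from (22): `R g' = −2 g`; substitute into `R ×` (19)
      have h3 : b * (R * deriv g R) = b * (-2 * g R) := by linear_combination (-1 : ℝ) * h2
      have h4 : R * deriv g R = -2 * g R := mul_left_cancel₀ hb h3
      have h5 : (1 - γ / 2) * g R * R + γ * R * (R * deriv g R) - b * (R * deriv g R) = 0 := by
        linear_combination R * h1
      rw [h4] at h5
      linear_combination h5
    have hgcont : ContinuousOn g (Iio 0) := hg1.continuousOn
    have hg0 : ∀ R : ℝ, R < 0 → g R = 0 := by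
      intro R₀ hR₀
      by_contra hne
      -- `g ≠ 0` near `R₀`, so the affine factor vanishes near `R₀`: impossible as `b ≠ 0`
      have hlin : ∀ R : ℝ, R < 0 → g R ≠ 0 → (1 - 5 * γ / 2) * R + 2 * b = 0 := fun R hR hgR =>
        (mul_eq_zero.1 (hprod R hR)).resolve_left hgR
      have hev : ∀ᶠ R in 𝓝 R₀, g R ≠ 0 :=
        (hgcont.continuousAt (Iio_mem_nhds hR₀)).eventually_ne hne
      obtain ⟨ε, hε, hball⟩ := Metric.mem_nhds_iff.1 (Filter.inter_mem hev (Iio_mem_nhds hR₀))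
      have hR₁ : R₀ - ε / 2 ∈ Metric.ball R₀ ε := by
        rw [Metric.mem_ball, Real.dist_eq, show R₀ - ε / 2 - R₀ = -(ε / 2) by ring, abs_neg,
          abs_of_pos (half_pos hε)]
        linarith
      obtain ⟨hg₁, hlt₁⟩ := hball hR₁
      have e0 := hlin R₀ hR₀ hne
      have e1 := hlin (R₀ - ε / 2) hlt₁ hg₁
      have : (1 - 5 * γ / 2) * (ε / 2) = 0 := by linear_combination e0 - e1
      rcases mul_eq_zero.1 this with h | h
      · rw [h, zero_mul, zero_add] at e0
        exact hb (by linarith)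
      · linarith
    rw [hUeq Y hY]
    exact hg0 Y.1 hY

end Core


/-! ### Calculus of the rescaled profiles `q ↦ c · G((r − 1)/s, z/s)` and of the time factor -/

section Rescale

variable {G : ℝ × ℝ → ℝ}

/-- The Luo–Hou change of variables `(r, z) ↦ (R, Z) = ((r − 1)/s, z/s)` has derivative
`s⁻¹ · id`. [cite: ChaeTsai2015, §2 (14)] -/
theorem hasFDerivAt_luoHouCoords (s : ℝ) (q : ℝ × ℝ) :
    HasFDerivAt (fun q' : ℝ × ℝ => ((q'.1 - 1) / s, q'.2 / s))
      (s⁻¹ • ContinuousLinearMap.id ℝ (ℝ × ℝ)) q := by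
  have e : (fun q' : ℝ × ℝ => ((q'.1 - 1) / s, q'.2 / s)) =
      fun q' => s⁻¹ • q' + ((-1 : ℝ) / s, (0 : ℝ)) := by
    funext q'
    ext
    · simp [div_eq_inv_mul]; ring
    · simp [div_eq_inv_mul]
  rw [e]
  exact ((ContinuousLinearMap.id ℝ (ℝ × ℝ)).hasFDerivAt.const_smul s⁻¹).add_const _

/-- `∂_r [c G((r−1)/s, z/s)] = c s⁻¹ (∂_R G)((r−1)/s, z/s)`. [cite: ChaeTsai2015, §2 (16)–(18)] -/
theorem derivR_rescale (c : ℝ) {s : ℝ} {q : ℝ × ℝ}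
    (hG : DifferentiableAt ℝ G ((q.1 - 1) / s, q.2 / s)) :
    derivR (fun q' : ℝ × ℝ => c * G ((q'.1 - 1) / s, q'.2 / s)) q =
      c * s⁻¹ * derivR G ((q.1 - 1) / s, q.2 / s) := by
  have hA := hasFDerivAt_luoHouCoords s q
  have hcomp : HasFDerivAt (fun q' : ℝ × ℝ => G ((q'.1 - 1) / s, q'.2 / s))
      ((fderiv ℝ G ((q.1 - 1) / s, q.2 / s)).comp (s⁻¹ • ContinuousLinearMap.id ℝ (ℝ × ℝ))) q :=
    hG.hasFDerivAt.comp q hA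
  have hc := hcomp.const_mul c
  rw [derivR_apply, hc.fderiv, derivR_apply]
  simp only [FunLike.coe_smul, Pi.smul_apply, ContinuousLinearMap.comp_apply,
    ContinuousLinearMap.id_apply, map_smul, smul_eq_mul]
  ring

/-- `∂_z [c G((r−1)/s, z/s)] = c s⁻¹ (∂_Z G)((r−1)/s, z/s)`. [cite: ChaeTsai2015, §2 (16)–(18)] -/
theorem derivZ_rescale (c : ℝ) {s : ℝ} {q : ℝ × ℝ}
    (hG : DifferentiableAt ℝ G ((q.1 - 1) / s, q.2 / s)) :
    derivZ (fun q' : ℝ × ℝ => c * G ((q'.1 - 1) / s, q'.2 / s)) q =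
      c * s⁻¹ * derivZ G ((q.1 - 1) / s, q.2 / s) := by
  have hA := hasFDerivAt_luoHouCoords s q
  have hcomp : HasFDerivAt (fun q' : ℝ × ℝ => G ((q'.1 - 1) / s, q'.2 / s))
      ((fderiv ℝ G ((q.1 - 1) / s, q.2 / s)).comp (s⁻¹ • ContinuousLinearMap.id ℝ (ℝ × ℝ))) q :=
    hG.hasFDerivAt.comp q hA
  have hc := hcomp.const_mul c
  rw [derivZ_apply, hc.fderiv, derivZ_apply]
  simp only [FunLike.coe_smul, Pi.smul_apply, ContinuousLinearMap.comp_apply,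
    ContinuousLinearMap.id_apply, map_smul, smul_eq_mul]
  ring

variable {f : ℝ × ℝ → ℝ}

/-- Eventual version of `derivR_rescale`: a function agreeing with `c G((r−1)/s, z/s)` near `q`.
[cite: ChaeTsai2015, §2 (16)–(18)] -/
theorem derivR_of_eventuallyEq_rescale (c : ℝ) {s : ℝ} {q : ℝ × ℝ}
    (hf : f =ᶠ[𝓝 q] fun q' => c * G ((q'.1 - 1) / s, q'.2 / s))
    (hG : DifferentiableAt ℝ G ((q.1 - 1) / s, q.2 / s)) :
    derivR f q = c * s⁻¹ * derivR G ((q.1 - 1) / s, q.2 / s) := by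
  rw [derivR_apply, hf.fderiv_eq, ← derivR_apply, derivR_rescale c hG]

/-- Eventual version of `derivZ_rescale`. [cite: ChaeTsai2015, §2 (16)–(18)] -/
theorem derivZ_of_eventuallyEq_rescale (c : ℝ) {s : ℝ} {q : ℝ × ℝ}
    (hf : f =ᶠ[𝓝 q] fun q' => c * G ((q'.1 - 1) / s, q'.2 / s))
    (hG : DifferentiableAt ℝ G ((q.1 - 1) / s, q.2 / s)) :
    derivZ f q = c * s⁻¹ * derivZ G ((q.1 - 1) / s, q.2 / s) := by
  rw [derivZ_apply, hf.fderiv_eq, ← derivZ_apply, derivZ_rescale c hG]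

/-- The change of variables maps a neighbourhood of `q` into the left half-plane when it maps `q`
there. [folklore] -/
private theorem eventually_luoHouCoords_mem {s : ℝ} {q : ℝ × ℝ} (hq : (q.1 - 1) / s < 0) :
    ∀ᶠ q' : ℝ × ℝ in 𝓝 q, (q'.1 - 1) / s < 0 := by
  have hc : Continuous fun q' : ℝ × ℝ => (q'.1 - 1) / s :=
    (continuous_fst.sub continuous_const).div_const s
  exact (hc.tendsto q).eventually (Iio_mem_nhds hq)

/-- First partials of a function agreeing near `q` with a rescaled `C¹` profile, as FUNCTIONS near
`q`: `∂_r f = c s⁻¹ (∂_R G) ∘ A` and `∂_z f = c s⁻¹ (∂_Z G) ∘ A` eventually.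
[cite: ChaeTsai2015, §2 (16)–(18)] -/
theorem derivR_derivZ_eventuallyEq_rescale {n : WithTop ℕ∞} (c : ℝ) {s : ℝ} {q : ℝ × ℝ}
    (hG : ContDiffOn ℝ n G {Y : ℝ × ℝ | Y.1 < 0}) (hn : n ≠ 0)
    (hf : f =ᶠ[𝓝 q] fun q' => c * G ((q'.1 - 1) / s, q'.2 / s)) (hq : (q.1 - 1) / s < 0) :
    (derivR f =ᶠ[𝓝 q] fun q' => c * s⁻¹ * derivR G ((q'.1 - 1) / s, q'.2 / s)) ∧
    (derivZ f =ᶠ[𝓝 q] fun q' => c * s⁻¹ * derivZ G ((q'.1 - 1) / s, q'.2 / s)) := by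
  have h1 := hf.eventually_nhds
  have h2 := eventually_luoHouCoords_mem hq
  constructor
  · filter_upwards [h1, h2] with q' hq'1 hq'2
    exact derivR_of_eventuallyEq_rescale c hq'1
      (differentiableAt_of_contDiffOn_leftHalfPlane hG hn hq'2)
  · filter_upwards [h1, h2] with q' hq'1 hq'2
    exact derivZ_of_eventuallyEq_rescale c hq'1
      (differentiableAt_of_contDiffOn_leftHalfPlane hG hn hq'2)

/-- Second partials `∂_r∂_r`, `∂_z∂_z` of a function agreeing near `q` with a rescaled `C²`
profile: `∂_r∂_r f(q) = c s⁻² (∂_R∂_R G)(A q)`, `∂_z∂_z f(q) = c s⁻² (∂_Z∂_Z G)(A q)`.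
[cite: ChaeTsai2015, §2 (18)] -/
theorem derivR_derivR_derivZ_derivZ_rescale (c : ℝ) {s : ℝ} {q : ℝ × ℝ}
    (hG : ContDiffOn ℝ 2 G {Y : ℝ × ℝ | Y.1 < 0})
    (hf : f =ᶠ[𝓝 q] fun q' => c * G ((q'.1 - 1) / s, q'.2 / s)) (hq : (q.1 - 1) / s < 0) :
    derivR (derivR f) q = c * s⁻¹ * s⁻¹ * derivR (derivR G) ((q.1 - 1) / s, q.2 / s) ∧
    derivZ (derivZ f) q = c * s⁻¹ * s⁻¹ * derivZ (derivZ G) ((q.1 - 1) / s, q.2 / s) := by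
  obtain ⟨hR, hZ⟩ := derivR_derivZ_eventuallyEq_rescale c hG two_ne_zero hf hq
  exact ⟨derivR_of_eventuallyEq_rescale (c * s⁻¹) hR
      (differentiableAt_of_contDiffOn_leftHalfPlane (contDiffOn_derivR hG) one_ne_zero hq),
    derivZ_of_eventuallyEq_rescale (c * s⁻¹) hZ
      (differentiableAt_of_contDiffOn_leftHalfPlane (contDiffOn_derivZ hG) one_ne_zero hq)⟩

/-- **The time derivative of the ansatz.** For `t < T`, `τ = T − t`, and a profile `G`
differentiable at `Y = ((r−1)/τ^γ, z/τ^γ)`: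
`∂_t [(T−t)^a G((r−1)/(T−t)^γ, z/(T−t)^γ)] = τ^a τ⁻¹ (−a G(Y) + γ (R ∂_R G + Z ∂_Z G)(Y))`
(`∂_t R = γR/(T−t)`, `∂_t Z = γZ/(T−t)`). [cite: ChaeTsai2015, §2 (16)–(17), first two terms] -/
theorem hasDerivAt_rescale_time {T γ a t : ℝ} {q Y : ℝ × ℝ} (ht : t < T)
    (hY : Y = ((q.1 - 1) / (T - t) ^ γ, q.2 / (T - t) ^ γ)) (hG : DifferentiableAt ℝ G Y) :
    HasDerivAt (fun t' : ℝ => (T - t') ^ a * G ((q.1 - 1) / (T - t') ^ γ, q.2 / (T - t') ^ γ))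
      ((T - t) ^ a * (T - t)⁻¹ *
        (-a * G Y + γ * (Y.1 * derivR G Y + Y.2 * derivZ G Y))) t := by
  have hτ : 0 < T - t := sub_pos.2 ht
  have hτ0 : T - t ≠ 0 := hτ.ne'
  -- the time factor
  have hsub : HasDerivAt (fun t' : ℝ => T - t') (-1) t := by
    simpa using (hasDerivAt_id t).const_sub T
  have hpa : HasDerivAt (fun t' : ℝ => (T - t') ^ a) ((-1) * a * (T - t) ^ (a - 1)) t :=
    hsub.rpow_const (Or.inl hτ0)
  -- the inverse scale `(T − t')^{−γ}`
  have hpg : HasDerivAt (fun t' : ℝ => (T - t') ^ (-γ)) ((-1) * (-γ) * (T - t) ^ (-γ - 1)) t :=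
    hsub.rpow_const (Or.inl hτ0)
  have hinv : ∀ t' : ℝ, t' < T → ((T - t') ^ γ)⁻¹ = (T - t') ^ (-γ) := fun t' ht' => by
    rw [Real.rpow_neg (sub_pos.2 ht').le]
  -- the coordinates as functions of time
  have hcoordR : HasDerivAt (fun t' : ℝ => (q.1 - 1) / (T - t') ^ γ)
      ((q.1 - 1) * ((-1) * (-γ) * (T - t) ^ (-γ - 1))) t := by
    have h := hpg.const_mul (q.1 - 1)
    refine h.congr_of_eventuallyEq ?_
    filter_upwards [Iio_mem_nhds ht] with t' ht'
    rw [div_eq_mul_inv, hinv t' ht']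
  have hcoordZ : HasDerivAt (fun t' : ℝ => q.2 / (T - t') ^ γ)
      (q.2 * ((-1) * (-γ) * (T - t) ^ (-γ - 1))) t := by
    have h := hpg.const_mul q.2
    refine h.congr_of_eventuallyEq ?_
    filter_upwards [Iio_mem_nhds ht] with t' ht'
    rw [div_eq_mul_inv, hinv t' ht']
  have hcoord : HasDerivAt (fun t' : ℝ => (((q.1 - 1) / (T - t') ^ γ, q.2 / (T - t') ^ γ) : ℝ × ℝ))
      ((q.1 - 1) * ((-1) * (-γ) * (T - t) ^ (-γ - 1)), q.2 * ((-1) * (-γ) * (T - t) ^ (-γ - 1))) t :=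
    hcoordR.prodMk hcoordZ
  have hGt : HasDerivAt (fun t' : ℝ => G ((q.1 - 1) / (T - t') ^ γ, q.2 / (T - t') ^ γ))
      (fderiv ℝ G Y ((q.1 - 1) * ((-1) * (-γ) * (T - t) ^ (-γ - 1)),
        q.2 * ((-1) * (-γ) * (T - t) ^ (-γ - 1)))) t := by
    have hGY : HasFDerivAt G (fderiv ℝ G Y) ((q.1 - 1) / (T - t) ^ γ, q.2 / (T - t) ^ γ) := by
      rw [← hY]; exact hG.hasFDerivAt
    exact hGY.comp_hasDerivAt t hcoord
  have hprod := hpa.mul hGt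
  -- identify the value
  have hlin : fderiv ℝ G Y ((q.1 - 1) * ((-1) * (-γ) * (T - t) ^ (-γ - 1)),
      q.2 * ((-1) * (-γ) * (T - t) ^ (-γ - 1))) =
      γ * (T - t)⁻¹ * (Y.1 * derivR G Y + Y.2 * derivZ G Y) := by
    have hR1 : Y.1 = (q.1 - 1) * (T - t) ^ (-γ) := by
      rw [hY]; simp only; rw [div_eq_mul_inv, hinv t ht]
    have hR2 : Y.2 = q.2 * (T - t) ^ (-γ) := by
      rw [hY]; simp only; rw [div_eq_mul_inv, hinv t ht]
    have hpow : (T - t) ^ (-γ - 1) = (T - t) ^ (-γ) * (T - t)⁻¹ := by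
      rw [Real.rpow_sub hτ, Real.rpow_one, div_eq_mul_inv]
    have hvec : (((q.1 - 1) * ((-1) * (-γ) * (T - t) ^ (-γ - 1)),
        q.2 * ((-1) * (-γ) * (T - t) ^ (-γ - 1))) : ℝ × ℝ) =
        (γ * (T - t)⁻¹ * Y.1) • ((1 : ℝ), (0 : ℝ)) + (γ * (T - t)⁻¹ * Y.2) • ((0 : ℝ), (1 : ℝ)) := by
      rw [hR1, hR2, hpow]
      ext <;> simp <;> ring
    rw [hvec, map_add, map_smul, map_smul, derivR_apply, derivZ_apply, smul_eq_mul, smul_eq_mul]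
    ring
  rw [hlin] at hprod
  have hval : (-1) * a * (T - t) ^ (a - 1) * G ((q.1 - 1) / (T - t) ^ γ, q.2 / (T - t) ^ γ) +
      (T - t) ^ a * (γ * (T - t)⁻¹ * (Y.1 * derivR G Y + Y.2 * derivZ G Y)) =
      (T - t) ^ a * (T - t)⁻¹ * (-a * G Y + γ * (Y.1 * derivR G Y + Y.2 * derivZ G Y)) := by
    rw [Real.rpow_sub_one hτ0, ← hY]
    rw [div_eq_mul_inv]
    ring
  rw [hval] at hprod
  exact hprod

end Rescale


/-! ### Substituting the ansatz into the `(u₁, ω₁, ψ₁)` Euler system: equations (16)–(18) -/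

section Substitution

variable {S : Set ℝ} {T γ t : ℝ} {q Y : ℝ × ℝ}
  {u₁ ω₁ ψ₁ : ℝ → ℝ × ℝ → ℝ} {U Ω Ψ : ℝ × ℝ → ℝ}

/-- Power bookkeeping for `τ = T − t > 0`, `s = τ^γ`, `μ = τ^{−1−γ/2}`, `ν = τ^{−1−γ}`:
`τ^{−1+γ/2} = μ s`, `τ⁻¹ = ν s`, `τ^{−1+2γ} = ν s³`, `μ² = ν² s`. [folklore] -/
private theorem rpow_bookkeeping {τ γ : ℝ} (hτ : 0 < τ) :
    τ ^ (-1 + γ / 2) = τ ^ (-1 - γ / 2) * τ ^ γ ∧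
    τ⁻¹ = τ ^ (-1 - γ) * τ ^ γ ∧
    τ ^ (-1 + 2 * γ) = τ ^ (-1 - γ) * (τ ^ γ) ^ 3 ∧
    τ ^ (-1 - γ / 2) * τ ^ (-1 - γ / 2) = τ ^ (-1 - γ) * τ ^ (-1 - γ) * τ ^ γ := by
  refine ⟨?_, ?_, ?_, ?_⟩
  · rw [← Real.rpow_add hτ]; ring_nf
  · rw [← Real.rpow_add hτ, ← Real.rpow_neg_one]; ring_nf
  · rw [show ((τ ^ γ) ^ 3 : ℝ) = τ ^ (γ * 3) by rw [Real.rpow_mul hτ.le]; norm_num,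
      ← Real.rpow_add hτ]; ring_nf
  · rw [← Real.rpow_add hτ, ← Real.rpow_add hτ, ← Real.rpow_add hτ]; ring_nf

/-- **Chae–Tsai (16)–(18) / Sperone (3.6)–(3.11), with the powers of `T − t` collected.** At a
space–time point `(t, q)`, `t < T`, `q = (r, z)` with `r > 0`, let the `(u₁, ω₁, ψ₁)`-form of
the axisymmetric Euler equations hold (`GeneralizedAxisymNS S 3 0`, i.e. (01)–(03):
`u₁,t + u^r u₁,r + u^z u₁,z = 2u₁ψ₁,z`, `ω₁,t + u^r ω₁,r + u^z ω₁,z = (u₁²)_z`,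
`−(∂_rr + (3/r)∂_r + ∂_zz)ψ₁ = ω₁`, `u^r = −rψ₁,z`, `u^z = 2ψ₁ + rψ₁,r`), let the slices
`u₁(t,·), ω₁(t,·), ψ₁(t,·)` agree near `q` with Luo–Hou's ansatz (11)–(13)
`(T−t)^{−1+γ/2} U(R,Z)`, `(T−t)^{−1} Ω(R,Z)`, `(T−t)^{−1+2γ} Ψ(R,Z)`, `R = (r−1)/(T−t)^γ`,
`Z = z/(T−t)^γ`, with `C¹`/`C¹`/`C²` profiles on the left half-plane and `Y = (R, Z)` there, and
let the time derivatives at `(t, q)` be those of the ansatz. Then, with `s = (T−t)^γ`, the three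
identities "leading order `+ s ·` next order `= 0`" hold at `Y`:
(16) `[(1−γ/2)U + γY·∇U + ∇⊥Ψ·∇U] + s[R ∇⊥Ψ·∇U + 2Ψ∂_ZU − 2U∂_ZΨ] = 0`,
(17) `[Ω + γY·∇Ω + ∇⊥Ψ·∇Ω − ∂_Z(U²)] + s[R ∇⊥Ψ·∇Ω + 2Ψ∂_ZΩ] = 0`,
(18) `[−ΔΨ − Ω] + s[−RΔΨ − 3∂_RΨ − RΩ] = 0`.
[cite: ChaeTsai2015, §2 (16)–(18) (arXiv p. 4); Sperone2017, §3 (3.5)–(3.11)] -/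
theorem substitution (ht : t < T) (hq : 0 < q.1)
    (hY : Y = ((q.1 - 1) / (T - t) ^ γ, q.2 / (T - t) ^ γ)) (hY1 : Y.1 < 0)
    (hU : ContDiffOn ℝ 1 U {Y : ℝ × ℝ | Y.1 < 0}) (hΩ : ContDiffOn ℝ 1 Ω {Y : ℝ × ℝ | Y.1 < 0})
    (hΨ : ContDiffOn ℝ 2 Ψ {Y : ℝ × ℝ | Y.1 < 0})
    (hE : GeneralizedAxisymNS S 3 0 u₁ ω₁ ψ₁ t q)
    (hu : u₁ t =ᶠ[𝓝 q] fun q' =>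
      (T - t) ^ (-1 + γ / 2) * U ((q'.1 - 1) / (T - t) ^ γ, q'.2 / (T - t) ^ γ))
    (hω : ω₁ t =ᶠ[𝓝 q] fun q' =>
      (T - t)⁻¹ * Ω ((q'.1 - 1) / (T - t) ^ γ, q'.2 / (T - t) ^ γ))
    (hψ : ψ₁ t =ᶠ[𝓝 q] fun q' =>
      (T - t) ^ (-1 + 2 * γ) * Ψ ((q'.1 - 1) / (T - t) ^ γ, q'.2 / (T - t) ^ γ))
    (hdu : timeDerivWithin S u₁ t q = (T - t) ^ (-1 + γ / 2) * (T - t)⁻¹ *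
      ((1 - γ / 2) * U Y + γ * (Y.1 * derivR U Y + Y.2 * derivZ U Y)))
    (hdω : timeDerivWithin S ω₁ t q = (T - t)⁻¹ * (T - t)⁻¹ *
      (Ω Y + γ * (Y.1 * derivR Ω Y + Y.2 * derivZ Ω Y))) :
    ((1 - γ / 2) * U Y + γ * (Y.1 * derivR U Y + Y.2 * derivZ U Y) +
        (-derivZ Ψ Y * derivR U Y + derivR Ψ Y * derivZ U Y) +
      (T - t) ^ γ * (Y.1 * (-derivZ Ψ Y * derivR U Y + derivR Ψ Y * derivZ U Y) +
        2 * Ψ Y * derivZ U Y - 2 * U Y * derivZ Ψ Y) = 0) ∧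
    (Ω Y + γ * (Y.1 * derivR Ω Y + Y.2 * derivZ Ω Y) +
        (-derivZ Ψ Y * derivR Ω Y + derivR Ψ Y * derivZ Ω Y) - derivZ (fun Y' => U Y' ^ 2) Y +
      (T - t) ^ γ * (Y.1 * (-derivZ Ψ Y * derivR Ω Y + derivR Ψ Y * derivZ Ω Y) +
        2 * Ψ Y * derivZ Ω Y) = 0) ∧
    (-(derivR (derivR Ψ) Y + derivZ (derivZ Ψ) Y) - Ω Y +
      (T - t) ^ γ * (-(Y.1 * (derivR (derivR Ψ) Y + derivZ (derivZ Ψ) Y)) - 3 * derivR Ψ Y -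
        Y.1 * Ω Y) = 0) := by
  have hτ : 0 < T - t := sub_pos.2 ht
  obtain ⟨hcu, hι, hcψ, hμν⟩ := rpow_bookkeeping (γ := γ) hτ
  have hs : 0 < (T - t) ^ γ := Real.rpow_pos_of_pos hτ _
  have hμ : 0 < (T - t) ^ (-1 - γ / 2) := Real.rpow_pos_of_pos hτ _
  have hν : 0 < (T - t) ^ (-1 - γ) := Real.rpow_pos_of_pos hτ _
  -- the point `Y` in the form used by the rescaling lemmas
  have hYpt : ((q.1 - 1) / (T - t) ^ γ, q.2 / (T - t) ^ γ) = Y := hY.symm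
  have hq1 : q.1 = 1 + (T - t) ^ γ * Y.1 := by
    rw [hY]; simp only; field_simp; ring
  have hY1' : (q.1 - 1) / (T - t) ^ γ < 0 := by rw [hY] at hY1; exact hY1
  -- differentiability of the profiles at `Y`
  have hUd : DifferentiableAt ℝ U ((q.1 - 1) / (T - t) ^ γ, q.2 / (T - t) ^ γ) :=
    differentiableAt_of_contDiffOn_leftHalfPlane hU one_ne_zero hY1'
  have hU2d : DifferentiableAt ℝ (fun Y' => U Y' ^ 2)
      ((q.1 - 1) / (T - t) ^ γ, q.2 / (T - t) ^ γ) :=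
    differentiableAt_of_contDiffOn_leftHalfPlane (hU.pow 2) one_ne_zero hY1'
  have hΩd : DifferentiableAt ℝ Ω ((q.1 - 1) / (T - t) ^ γ, q.2 / (T - t) ^ γ) :=
    differentiableAt_of_contDiffOn_leftHalfPlane hΩ one_ne_zero hY1'
  have hΨd : DifferentiableAt ℝ Ψ ((q.1 - 1) / (T - t) ^ γ, q.2 / (T - t) ^ γ) :=
    differentiableAt_of_contDiffOn_leftHalfPlane hΨ two_ne_zero hY1'
  -- values at `q`
  have hu0 : u₁ t q = (T - t) ^ (-1 + γ / 2) * U Y := by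
    have := hu.self_of_nhds; simp only at this; rw [this, hYpt]
  have hω0 : ω₁ t q = (T - t)⁻¹ * Ω Y := by
    have := hω.self_of_nhds; simp only at this; rw [this, hYpt]
  have hψ0 : ψ₁ t q = (T - t) ^ (-1 + 2 * γ) * Ψ Y := by
    have := hψ.self_of_nhds; simp only at this; rw [this, hYpt]
  -- first partials at `q`
  have duR := derivR_of_eventuallyEq_rescale _ hu hUd
  have duZ := derivZ_of_eventuallyEq_rescale _ hu hUd
  have dωR := derivR_of_eventuallyEq_rescale _ hω hΩd
  have dωZ := derivZ_of_eventuallyEq_rescale _ hω hΩd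
  have dψR := derivR_of_eventuallyEq_rescale _ hψ hΨd
  have dψZ := derivZ_of_eventuallyEq_rescale _ hψ hΨd
  -- second partials of `ψ₁`
  obtain ⟨dψRR, dψZZ⟩ := derivR_derivR_derivZ_derivZ_rescale _ hΨ hψ hY1'
  -- `∂_z (u₁²)`
  have hu2 : (fun q' => u₁ t q' ^ 2) =ᶠ[𝓝 q] fun q' =>
      ((T - t) ^ (-1 + γ / 2) * (T - t) ^ (-1 + γ / 2)) *
        (fun Y' => U Y' ^ 2) ((q'.1 - 1) / (T - t) ^ γ, q'.2 / (T - t) ^ γ) := by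
    filter_upwards [hu] with q' hq'
    rw [hq']; ring
  have du2Z := derivZ_of_eventuallyEq_rescale _ hu2 hU2d
  rw [hYpt] at duR duZ dωR dωZ dψR dψZ dψRR dψZZ du2Z
  -- the three equations
  have e1 := hE.swirl_eq
  have e2 := hE.vorticity_eq
  have e3 := hE.stream_eq
  simp only [GeneralizedAxisymNS.radialVel, GeneralizedAxisymNS.axialVel,
    GeneralizedAxisymNS.lap, zero_mul, add_zero] at e1 e2 e3
  rw [hdu, duR, duZ, dψR, dψZ, hu0, hψ0] at e1
  rw [hdω, dωR, dωZ, dψR, dψZ, hψ0, hω0, du2Z] at e2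
  rw [dψRR, dψZZ, dψR, hω0] at e3
  -- rewrite all powers of `T − t` in terms of `μ = τ^{−1−γ/2}`, `ν = τ^{−1−γ}`, `s = τ^γ`
  rw [hcu, hcψ, hι, hq1] at e1
  rw [hcu, hcψ, hι, hq1] at e2
  rw [hcψ, hι, hq1] at e3
  set s : ℝ := (T - t) ^ γ with hsdef
  set μ : ℝ := (T - t) ^ (-1 - γ / 2) with hμdef
  set ν : ℝ := (T - t) ^ (-1 - γ) with hνdef
  have hs0 : s ≠ 0 := hs.ne'
  have hr0 : 1 + s * Y.1 ≠ 0 := by rw [← hq1]; exact hq.ne'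
  -- clear the inverse powers of `s`
  have c1 : μ * s * s⁻¹ = μ := by field_simp
  have c2 : ν * s * s⁻¹ = ν := by field_simp
  have c3 : ν * s ^ 3 * s⁻¹ = ν * s ^ 2 := by field_simp
  have c4' : ν * s ^ 2 * s⁻¹ = ν * s := by field_simp
  have c5 : μ * s * (μ * s) * s⁻¹ = μ * μ * s := by field_simp
  simp only [c1, c2, c3, c4', c5] at e1 e2 e3
  refine ⟨?_, ?_, ?_⟩
  · have key : μ * ν * s ^ 2 * ((1 - γ / 2) * U Y + γ * (Y.1 * derivR U Y + Y.2 * derivZ U Y) +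
        (-derivZ Ψ Y * derivR U Y + derivR Ψ Y * derivZ U Y) +
      s * (Y.1 * (-derivZ Ψ Y * derivR U Y + derivR Ψ Y * derivZ U Y) +
        2 * Ψ Y * derivZ U Y - 2 * U Y * derivZ Ψ Y)) = 0 := by
      linear_combination e1
    have hne : μ * ν * s ^ 2 ≠ 0 := by positivity
    exact (mul_eq_zero.1 key).resolve_left hne
  · have key : ν * ν * s ^ 2 * (Ω Y + γ * (Y.1 * derivR Ω Y + Y.2 * derivZ Ω Y) +
        (-derivZ Ψ Y * derivR Ω Y + derivR Ψ Y * derivZ Ω Y) - derivZ (fun Y' => U Y' ^ 2) Y +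
      s * (Y.1 * (-derivZ Ψ Y * derivR Ω Y + derivR Ψ Y * derivZ Ω Y) +
        2 * Ψ Y * derivZ Ω Y)) = 0 := by
      linear_combination e2 + (s * derivZ (fun Y' => U Y' ^ 2) Y) * hμν
    have hne : ν * ν * s ^ 2 ≠ 0 := by positivity
    exact (mul_eq_zero.1 key).resolve_left hne
  · have hρ3 : (3 : ℝ) / (1 + s * Y.1) * (1 + s * Y.1) = 3 := div_mul_cancel₀ _ hr0
    have e3' : (-(ν * s * derivR (derivR Ψ) Y + 3 / (1 + s * Y.1) * (ν * s ^ 2 * derivR Ψ Y) +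
        ν * s * derivZ (derivZ Ψ) Y)) * (1 + s * Y.1) = ν * s * Ω Y * (1 + s * Y.1) := by
      rw [e3]
    have key : ν * s * (-(derivR (derivR Ψ) Y + derivZ (derivZ Ψ) Y) - Ω Y +
      s * (-(Y.1 * (derivR (derivR Ψ) Y + derivZ (derivZ Ψ) Y)) - 3 * derivR Ψ Y -
        Y.1 * Ω Y)) = 0 := by
      linear_combination e3' + (ν * s ^ 2 * derivR Ψ Y) * hρ3
    have hne : ν * s ≠ 0 := by positivity
    exact (mul_eq_zero.1 key).resolve_left hne

end Substitution


/-! ### Separation of the two orders and the region `𝒞_{δ,T}` -/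

section Region

variable {S : Set ℝ} {T γ δ : ℝ} {u₁ ω₁ ψ₁ : ℝ → ℝ × ℝ → ℝ} {U Ω Ψ : ℝ × ℝ → ℝ}

/-- An affine function of `s` vanishing at two distinct points vanishes identically: the
leading-order and next-order equations separate. [cite: ChaeTsai2015, §2 ("the equations for the most dominant terms … The next dominant equations")] -/
theorem coeff_eq_zero_of_two_scales {a b s₁ s₂ : ℝ} (hs : s₁ ≠ s₂) (h₁ : a + s₁ * b = 0)
    (h₂ : a + s₂ * b = 0) : a = 0 ∧ b = 0 := by
  have hb : (s₁ - s₂) * b = 0 := by linear_combination h₁ - h₂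
  have hb0 : b = 0 := (mul_eq_zero.1 hb).resolve_left (sub_ne_zero.2 hs)
  refine ⟨?_, hb0⟩
  rw [hb0, mul_zero, add_zero] at h₁
  exact h₁

/-- **(16)–(18) at a prescribed scale.** Under the ansatz (11)–(13) on the region
`𝒞_{δ,T} = {1 − δ < r < 1, |z| < δ, T − δ < t < T}` (with the `(u₁,ω₁,ψ₁)` Euler equations there),
for every profile point `Y = (R, Z)`, `R < 0`, and every scale `s > 0` small enough that
`t = T − s^{1/γ}` and `q = (1 + sR, sZ)` lie in the region, the identities (16)–(18) of
`substitution` hold at `Y` with `(T − t)^γ = s`. [cite: ChaeTsai2015, §2 (16)–(18) ("valid for all t sufficiently close to T")] -/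
theorem substitution_at_scale (hγ : 0 < γ) (hS : Ioo (T - δ) T ⊆ S)
    (hU : ContDiffOn ℝ 1 U {Y : ℝ × ℝ | Y.1 < 0}) (hΩ : ContDiffOn ℝ 1 Ω {Y : ℝ × ℝ | Y.1 < 0})
    (hΨ : ContDiffOn ℝ 2 Ψ {Y : ℝ × ℝ | Y.1 < 0})
    (hE : ∀ t ∈ Ioo (T - δ) T, ∀ q : ℝ × ℝ, 1 - δ < q.1 → q.1 < 1 → |q.2| < δ →
      GeneralizedAxisymNS S 3 0 u₁ ω₁ ψ₁ t q)
    (hu : ∀ t ∈ Ioo (T - δ) T, ∀ q : ℝ × ℝ, 1 - δ < q.1 → q.1 < 1 → |q.2| < δ →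
      u₁ t q = (T - t) ^ (-1 + γ / 2) * U ((q.1 - 1) / (T - t) ^ γ, q.2 / (T - t) ^ γ))
    (hω : ∀ t ∈ Ioo (T - δ) T, ∀ q : ℝ × ℝ, 1 - δ < q.1 → q.1 < 1 → |q.2| < δ →
      ω₁ t q = (T - t)⁻¹ * Ω ((q.1 - 1) / (T - t) ^ γ, q.2 / (T - t) ^ γ))
    (hψ : ∀ t ∈ Ioo (T - δ) T, ∀ q : ℝ × ℝ, 1 - δ < q.1 → q.1 < 1 → |q.2| < δ →
      ψ₁ t q = (T - t) ^ (-1 + 2 * γ) * Ψ ((q.1 - 1) / (T - t) ^ γ, q.2 / (T - t) ^ γ))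
    {Y : ℝ × ℝ} (hY1 : Y.1 < 0) {s : ℝ} (hs : 0 < s) (hsδ : s ^ γ⁻¹ < δ)
    (hsY1 : s * |Y.1| < min δ 1) (hsY2 : s * |Y.2| < δ) :
    ((1 - γ / 2) * U Y + γ * (Y.1 * derivR U Y + Y.2 * derivZ U Y) +
        (-derivZ Ψ Y * derivR U Y + derivR Ψ Y * derivZ U Y) +
      s * (Y.1 * (-derivZ Ψ Y * derivR U Y + derivR Ψ Y * derivZ U Y) +
        2 * Ψ Y * derivZ U Y - 2 * U Y * derivZ Ψ Y) = 0) ∧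
    (Ω Y + γ * (Y.1 * derivR Ω Y + Y.2 * derivZ Ω Y) +
        (-derivZ Ψ Y * derivR Ω Y + derivR Ψ Y * derivZ Ω Y) - derivZ (fun Y' => U Y' ^ 2) Y +
      s * (Y.1 * (-derivZ Ψ Y * derivR Ω Y + derivR Ψ Y * derivZ Ω Y) +
        2 * Ψ Y * derivZ Ω Y) = 0) ∧
    (-(derivR (derivR Ψ) Y + derivZ (derivZ Ψ) Y) - Ω Y +
      s * (-(Y.1 * (derivR (derivR Ψ) Y + derivZ (derivZ Ψ) Y)) - 3 * derivR Ψ Y -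
        Y.1 * Ω Y) = 0) := by
  -- the time `t = T − s^{1/γ}` and the point `q = (1 + sR, sZ)`
  set τ : ℝ := s ^ γ⁻¹ with hτdef
  have hτ : 0 < τ := Real.rpow_pos_of_pos hs _
  set t : ℝ := T - τ with htdef
  have hTt : T - t = τ := by rw [htdef]; ring
  have hτγ : (T - t) ^ γ = s := by
    rw [hTt, hτdef, ← Real.rpow_mul hs.le, inv_mul_cancel₀ hγ.ne', Real.rpow_one]
  have ht : t ∈ Ioo (T - δ) T := ⟨by rw [htdef]; linarith, by rw [htdef]; linarith⟩
  have htT : t < T := ht.2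
  set q : ℝ × ℝ := (1 + s * Y.1, s * Y.2) with hqdef
  have hY1abs : |Y.1| = -Y.1 := abs_of_neg hY1
  have hq1lt : q.1 < 1 := by
    show 1 + s * Y.1 < 1
    nlinarith
  have hq1gt : 1 - δ < q.1 := by
    show 1 - δ < 1 + s * Y.1
    have := lt_of_lt_of_le hsY1 (min_le_left _ _)
    rw [hY1abs] at this; linarith
  have hq1pos : 0 < q.1 := by
    show 0 < 1 + s * Y.1
    have := lt_of_lt_of_le hsY1 (min_le_right _ _)
    rw [hY1abs] at this; linarith
  have hq2 : |q.2| < δ := by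
    show |s * Y.2| < δ
    rwa [abs_mul, abs_of_pos hs]
  have hYq : Y = ((q.1 - 1) / (T - t) ^ γ, q.2 / (T - t) ^ γ) := by
    rw [hτγ]
    ext
    · show Y.1 = (1 + s * Y.1 - 1) / s
      field_simp; ring
    · show Y.2 = s * Y.2 / s
      field_simp
  -- the spatial region is a neighbourhood of `q`
  have hreg : ∀ᶠ q' : ℝ × ℝ in 𝓝 q, 1 - δ < q'.1 ∧ q'.1 < 1 ∧ |q'.2| < δ := by
    have ho : IsOpen {q' : ℝ × ℝ | 1 - δ < q'.1 ∧ q'.1 < 1 ∧ |q'.2| < δ} :=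
      (isOpen_lt continuous_const continuous_fst).inter
        ((isOpen_lt continuous_fst continuous_const).inter
          (isOpen_lt (continuous_abs.comp continuous_snd) continuous_const))
    exact ho.mem_nhds ⟨hq1gt, hq1lt, hq2⟩
  have hu' : u₁ t =ᶠ[𝓝 q] fun q' =>
      (T - t) ^ (-1 + γ / 2) * U ((q'.1 - 1) / (T - t) ^ γ, q'.2 / (T - t) ^ γ) :=
    hreg.mono fun q' hq' => hu t ht q' hq'.1 hq'.2.1 hq'.2.2
  have hω' : ω₁ t =ᶠ[𝓝 q] fun q' =>
      (T - t)⁻¹ * Ω ((q'.1 - 1) / (T - t) ^ γ, q'.2 / (T - t) ^ γ) :=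
    hreg.mono fun q' hq' => hω t ht q' hq'.1 hq'.2.1 hq'.2.2
  have hψ' : ψ₁ t =ᶠ[𝓝 q] fun q' =>
      (T - t) ^ (-1 + 2 * γ) * Ψ ((q'.1 - 1) / (T - t) ^ γ, q'.2 / (T - t) ^ γ) :=
    hreg.mono fun q' hq' => hψ t ht q' hq'.1 hq'.2.1 hq'.2.2
  -- time derivatives: the ansatz holds at `q` for all times in the open interval `(T − δ, T)`
  have hSt : S ∈ 𝓝 t := Filter.mem_of_superset (isOpen_Ioo.mem_nhds ht) hS
  have hY1' : ((q.1 - 1) / (T - t) ^ γ, q.2 / (T - t) ^ γ).1 < 0 := by rw [← hYq]; exact hY1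
  have hUd : DifferentiableAt ℝ U ((q.1 - 1) / (T - t) ^ γ, q.2 / (T - t) ^ γ) :=
    differentiableAt_of_contDiffOn_leftHalfPlane hU one_ne_zero hY1'
  have hΩd : DifferentiableAt ℝ Ω ((q.1 - 1) / (T - t) ^ γ, q.2 / (T - t) ^ γ) :=
    differentiableAt_of_contDiffOn_leftHalfPlane hΩ one_ne_zero hY1'
  have hdu : timeDerivWithin S u₁ t q = (T - t) ^ (-1 + γ / 2) * (T - t)⁻¹ *
      ((1 - γ / 2) * U Y + γ * (Y.1 * derivR U Y + Y.2 * derivZ U Y)) := by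
    rw [timeDerivWithin_apply, derivWithin_of_mem_nhds hSt]
    have hev : (fun t' => u₁ t' q) =ᶠ[𝓝 t] fun t' =>
        (T - t') ^ (-1 + γ / 2) * U ((q.1 - 1) / (T - t') ^ γ, q.2 / (T - t') ^ γ) :=
      Filter.eventuallyEq_of_mem (isOpen_Ioo.mem_nhds ht) fun t' ht' =>
        hu t' ht' q hq1gt hq1lt hq2
    rw [hev.deriv_eq, (hasDerivAt_rescale_time (a := -1 + γ / 2) htT hYq (hYq ▸ hUd)).deriv]
    ring
  have hdω : timeDerivWithin S ω₁ t q = (T - t)⁻¹ * (T - t)⁻¹ *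
      (Ω Y + γ * (Y.1 * derivR Ω Y + Y.2 * derivZ Ω Y)) := by
    rw [timeDerivWithin_apply, derivWithin_of_mem_nhds hSt]
    have hev : (fun t' => ω₁ t' q) =ᶠ[𝓝 t] fun t' =>
        (T - t') ^ (-1 : ℝ) * Ω ((q.1 - 1) / (T - t') ^ γ, q.2 / (T - t') ^ γ) :=
      Filter.eventuallyEq_of_mem (isOpen_Ioo.mem_nhds ht) fun t' ht' => by
        rw [hω t' ht' q hq1gt hq1lt hq2, Real.rpow_neg_one]
    rw [hev.deriv_eq, (hasDerivAt_rescale_time (a := -1) htT hYq (hYq ▸ hΩd)).deriv,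
      Real.rpow_neg_one]
    ring
  have h := substitution htT hq1pos hYq hY1 hU hΩ hΨ (hE t ht q hq1gt hq1lt hq2) hu' hω' hψ'
    hdu hdω
  rwa [hτγ] at h

/-- **The six profile equations (19)–(24) from the ansatz on `𝒞_{δ,T}`.** Under the ansatz
(11)–(13) on `𝒞_{δ,T}` with the `(u₁, ω₁, ψ₁)` Euler equations there and `C¹/C¹/C²` profiles on
the left half-plane, the profiles satisfy, at every `Y = (R, Z)` with `R < 0`: the leading-order
system (19)–(21) and the next-order system (22)–(24) — two distinct admissible scales `s` in
(16)–(18) separate the orders. [cite: ChaeTsai2015, §2 (19)–(24); Sperone2017, §3 (3.12)–(3.20)] -/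
theorem profileSystem_of_region (hγ : 0 < γ) (hδ : 0 < δ) (hS : Ioo (T - δ) T ⊆ S)
    (hU : ContDiffOn ℝ 1 U {Y : ℝ × ℝ | Y.1 < 0}) (hΩ : ContDiffOn ℝ 1 Ω {Y : ℝ × ℝ | Y.1 < 0})
    (hΨ : ContDiffOn ℝ 2 Ψ {Y : ℝ × ℝ | Y.1 < 0})
    (hE : ∀ t ∈ Ioo (T - δ) T, ∀ q : ℝ × ℝ, 1 - δ < q.1 → q.1 < 1 → |q.2| < δ →
      GeneralizedAxisymNS S 3 0 u₁ ω₁ ψ₁ t q)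
    (hu : ∀ t ∈ Ioo (T - δ) T, ∀ q : ℝ × ℝ, 1 - δ < q.1 → q.1 < 1 → |q.2| < δ →
      u₁ t q = (T - t) ^ (-1 + γ / 2) * U ((q.1 - 1) / (T - t) ^ γ, q.2 / (T - t) ^ γ))
    (hω : ∀ t ∈ Ioo (T - δ) T, ∀ q : ℝ × ℝ, 1 - δ < q.1 → q.1 < 1 → |q.2| < δ →
      ω₁ t q = (T - t)⁻¹ * Ω ((q.1 - 1) / (T - t) ^ γ, q.2 / (T - t) ^ γ))
    (hψ : ∀ t ∈ Ioo (T - δ) T, ∀ q : ℝ × ℝ, 1 - δ < q.1 → q.1 < 1 → |q.2| < δ →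
      ψ₁ t q = (T - t) ^ (-1 + 2 * γ) * Ψ ((q.1 - 1) / (T - t) ^ γ, q.2 / (T - t) ^ γ))
    {Y : ℝ × ℝ} (hY1 : Y.1 < 0) :
    ((1 - γ / 2) * U Y + γ * (Y.1 * derivR U Y + Y.2 * derivZ U Y) +
        (-derivZ Ψ Y * derivR U Y + derivR Ψ Y * derivZ U Y) = 0) ∧
    (Ω Y + γ * (Y.1 * derivR Ω Y + Y.2 * derivZ Ω Y) +
        (-derivZ Ψ Y * derivR Ω Y + derivR Ψ Y * derivZ Ω Y) = derivZ (fun Y' => U Y' ^ 2) Y) ∧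
    (-(derivR (derivR Ψ) Y + derivZ (derivZ Ψ) Y) = Ω Y) ∧
    (Y.1 * (-derivZ Ψ Y * derivR U Y + derivR Ψ Y * derivZ U Y) + 2 * Ψ Y * derivZ U Y =
        2 * U Y * derivZ Ψ Y) ∧
    (Y.1 * (-derivZ Ψ Y * derivR Ω Y + derivR Ψ Y * derivZ Ω Y) + 2 * Ψ Y * derivZ Ω Y = 0) ∧
    derivR Ψ Y = 0 := by
  -- a scale bound `s₀ > 0` below which every `s` is admissible
  set δ' : ℝ := min δ 1 with hδ'
  have hδ'0 : 0 < δ' := lt_min hδ zero_lt_one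
  set M : ℝ := |Y.1| + |Y.2| + 1 with hM
  have hM0 : 0 < M := by positivity
  set s₀ : ℝ := min (δ' ^ γ) (δ' / M) with hs₀
  have hs₀0 : 0 < s₀ := lt_min (Real.rpow_pos_of_pos hδ'0 _) (div_pos hδ'0 hM0)
  have hadm : ∀ s : ℝ, 0 < s → s < s₀ →
      s ^ γ⁻¹ < δ ∧ s * |Y.1| < min δ 1 ∧ s * |Y.2| < δ := by
    intro s hs hss
    have h1 : s < δ' ^ γ := lt_of_lt_of_le hss (min_le_left _ _)
    have h2 : s < δ' / M := lt_of_lt_of_le hss (min_le_right _ _)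
    have hroot : s ^ γ⁻¹ < δ' := by
      have := Real.rpow_lt_rpow hs.le h1 (inv_pos.2 hγ)
      rwa [← Real.rpow_mul hδ'0.le, mul_inv_cancel₀ hγ.ne', Real.rpow_one] at this
    have hsM : s * M < δ' := by rwa [lt_div_iff₀ hM0] at h2
    refine ⟨lt_of_lt_of_le hroot (min_le_left _ _), ?_, ?_⟩
    · calc s * |Y.1| ≤ s * M := by
            apply mul_le_mul_of_nonneg_left _ hs.le
            rw [hM]; linarith [abs_nonneg Y.2]
        _ < δ' := hsM
    · calc s * |Y.2| ≤ s * M := by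
            apply mul_le_mul_of_nonneg_left _ hs.le
            rw [hM]; linarith [abs_nonneg Y.1]
        _ < δ' := hsM
        _ ≤ δ := min_le_left _ _
  -- two distinct admissible scales
  obtain ⟨a1, a3, a4⟩ := hadm (s₀ / 2) (by positivity) (by linarith)
  obtain ⟨b1, b3, b4⟩ := hadm (s₀ / 3) (by positivity) (by linarith)
  obtain ⟨hA16, hA17, hA18⟩ :=
    substitution_at_scale hγ hS hU hΩ hΨ hE hu hω hψ hY1 (by positivity) a1 a3 a4
  obtain ⟨hB16, hB17, hB18⟩ :=
    substitution_at_scale hγ hS hU hΩ hΨ hE hu hω hψ hY1 (by positivity) b1 b3 b4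
  have hne : s₀ / 2 ≠ s₀ / 3 := by
    intro h; have : s₀ = 0 := by linarith
    exact hs₀0.ne' this
  obtain ⟨h19, h22⟩ := coeff_eq_zero_of_two_scales hne hA16 hB16
  obtain ⟨h20, h23⟩ := coeff_eq_zero_of_two_scales hne hA17 hB17
  obtain ⟨h21, h24⟩ := coeff_eq_zero_of_two_scales hne hA18 hB18
  have h21' : -(derivR (derivR Ψ) Y + derivZ (derivZ Ψ) Y) = Ω Y := by linarith
  have h24' : derivR Ψ Y = 0 := by
    -- `−RΔΨ − 3Ψ_R − RΩ = 0` with `−ΔΨ = Ω`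
    have : -(Y.1 * (derivR (derivR Ψ) Y + derivZ (derivZ Ψ) Y)) - 3 * derivR Ψ Y -
        Y.1 * Ω Y = 0 := h24
    rw [← h21'] at this
    linarith
  refine ⟨h19, by linarith, h21', by linarith, h23, h24'⟩


/-! ### The shrinking window `𝒲_{δ(t)}` (Chae–Tsai's second alternative) -/

/-- One-sided agreement of differentiable functions gives equal derivatives. [folklore] -/
private theorem deriv_eq_of_eventuallyEq_nhdsLE {f g : ℝ → ℝ} {t : ℝ} (hf : DifferentiableAt ℝ f t)
    (hg : DifferentiableAt ℝ g t) (h : f =ᶠ[𝓝[≤] t] g) : deriv f t = deriv g t := by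
  rw [← hf.derivWithin (uniqueDiffWithinAt_Iic t), ← hg.derivWithin (uniqueDiffWithinAt_Iic t)]
  exact h.derivWithin_eq (h.self_of_nhdsWithin (mem_Iic.2 le_rfl))

/-- **(16)–(18) at an admissible time of the shrinking window.** Setting of Chae–Tsai's region
`𝒲_{δ(t)} = {1 − δ(t) < r < 1, |z| < δ(t), T₀ < t < T}` with `δ` non-increasing: if the ansatz
and the equations hold on `𝒲`, the solution is classical in time there (`u₁(·, q)`, `ω₁(·, q)`
differentiable), and at a time `t ∈ (T₀, T)` the point `q = (1 + (T−t)^γ R, (T−t)^γ Z)` lies in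
the window with `(T−t)^γ |R| < 1`, then (16)–(18) hold at `Y = (R, Z)` with `s = (T−t)^γ`.
[cite: ChaeTsai2015, §2 Thm. 1 with (thm2region2)–(thm2region2b) (arXiv p. 4)] -/
theorem substitution_at_window {T₀ : ℝ} {δf : ℝ → ℝ} (hS : Ioo T₀ T ⊆ S)
    (hanti : AntitoneOn δf (Ioo T₀ T))
    (hU : ContDiffOn ℝ 1 U {Y : ℝ × ℝ | Y.1 < 0}) (hΩ : ContDiffOn ℝ 1 Ω {Y : ℝ × ℝ | Y.1 < 0})
    (hΨ : ContDiffOn ℝ 2 Ψ {Y : ℝ × ℝ | Y.1 < 0})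
    (hE : ∀ t ∈ Ioo T₀ T, ∀ q : ℝ × ℝ, 1 - δf t < q.1 → q.1 < 1 → |q.2| < δf t →
      GeneralizedAxisymNS S 3 0 u₁ ω₁ ψ₁ t q)
    (hu : ∀ t ∈ Ioo T₀ T, ∀ q : ℝ × ℝ, 1 - δf t < q.1 → q.1 < 1 → |q.2| < δf t →
      u₁ t q = (T - t) ^ (-1 + γ / 2) * U ((q.1 - 1) / (T - t) ^ γ, q.2 / (T - t) ^ γ))
    (hω : ∀ t ∈ Ioo T₀ T, ∀ q : ℝ × ℝ, 1 - δf t < q.1 → q.1 < 1 → |q.2| < δf t →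
      ω₁ t q = (T - t)⁻¹ * Ω ((q.1 - 1) / (T - t) ^ γ, q.2 / (T - t) ^ γ))
    (hψ : ∀ t ∈ Ioo T₀ T, ∀ q : ℝ × ℝ, 1 - δf t < q.1 → q.1 < 1 → |q.2| < δf t →
      ψ₁ t q = (T - t) ^ (-1 + 2 * γ) * Ψ ((q.1 - 1) / (T - t) ^ γ, q.2 / (T - t) ^ γ))
    (hdiff : ∀ t ∈ Ioo T₀ T, ∀ q : ℝ × ℝ, 1 - δf t < q.1 → q.1 < 1 → |q.2| < δf t →
      DifferentiableAt ℝ (fun t' => u₁ t' q) t ∧ DifferentiableAt ℝ (fun t' => ω₁ t' q) t)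
    {Y : ℝ × ℝ} (hY1 : Y.1 < 0) {t : ℝ} (ht : t ∈ Ioo T₀ T)
    (htY1 : (T - t) ^ γ * |Y.1| < min (δf t) 1) (htY2 : (T - t) ^ γ * |Y.2| < δf t) :
    ((1 - γ / 2) * U Y + γ * (Y.1 * derivR U Y + Y.2 * derivZ U Y) +
        (-derivZ Ψ Y * derivR U Y + derivR Ψ Y * derivZ U Y) +
      (T - t) ^ γ * (Y.1 * (-derivZ Ψ Y * derivR U Y + derivR Ψ Y * derivZ U Y) +
        2 * Ψ Y * derivZ U Y - 2 * U Y * derivZ Ψ Y) = 0) ∧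
    (Ω Y + γ * (Y.1 * derivR Ω Y + Y.2 * derivZ Ω Y) +
        (-derivZ Ψ Y * derivR Ω Y + derivR Ψ Y * derivZ Ω Y) - derivZ (fun Y' => U Y' ^ 2) Y +
      (T - t) ^ γ * (Y.1 * (-derivZ Ψ Y * derivR Ω Y + derivR Ψ Y * derivZ Ω Y) +
        2 * Ψ Y * derivZ Ω Y) = 0) ∧
    (-(derivR (derivR Ψ) Y + derivZ (derivZ Ψ) Y) - Ω Y +
      (T - t) ^ γ * (-(Y.1 * (derivR (derivR Ψ) Y + derivZ (derivZ Ψ) Y)) - 3 * derivR Ψ Y -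
        Y.1 * Ω Y) = 0) := by
  have htT : t < T := ht.2
  have hτ : 0 < T - t := sub_pos.2 htT
  set s : ℝ := (T - t) ^ γ with hsdef
  have hs : 0 < s := Real.rpow_pos_of_pos hτ _
  set q : ℝ × ℝ := (1 + s * Y.1, s * Y.2) with hqdef
  have hY1abs : |Y.1| = -Y.1 := abs_of_neg hY1
  have hq1lt : q.1 < 1 := by
    show 1 + s * Y.1 < 1
    nlinarith
  have hq1gt : 1 - δf t < q.1 := by
    show 1 - δf t < 1 + s * Y.1
    have := lt_of_lt_of_le htY1 (min_le_left _ _)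
    rw [hY1abs] at this; linarith
  have hq1pos : 0 < q.1 := by
    show 0 < 1 + s * Y.1
    have := lt_of_lt_of_le htY1 (min_le_right _ _)
    rw [hY1abs] at this; linarith
  have hq2 : |q.2| < δf t := by
    show |s * Y.2| < δf t
    rwa [abs_mul, abs_of_pos hs]
  have hYq : Y = ((q.1 - 1) / (T - t) ^ γ, q.2 / (T - t) ^ γ) := by
    ext
    · show Y.1 = (1 + s * Y.1 - 1) / s
      field_simp; ring
    · show Y.2 = s * Y.2 / s
      field_simp
  -- the window's time slice is a neighbourhood of `q`
  have hreg : ∀ᶠ q' : ℝ × ℝ in 𝓝 q, 1 - δf t < q'.1 ∧ q'.1 < 1 ∧ |q'.2| < δf t := by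
    have ho : IsOpen {q' : ℝ × ℝ | 1 - δf t < q'.1 ∧ q'.1 < 1 ∧ |q'.2| < δf t} :=
      (isOpen_lt continuous_const continuous_fst).inter
        ((isOpen_lt continuous_fst continuous_const).inter
          (isOpen_lt (continuous_abs.comp continuous_snd) continuous_const))
    exact ho.mem_nhds ⟨hq1gt, hq1lt, hq2⟩
  have hu' : u₁ t =ᶠ[𝓝 q] fun q' =>
      (T - t) ^ (-1 + γ / 2) * U ((q'.1 - 1) / (T - t) ^ γ, q'.2 / (T - t) ^ γ) :=
    hreg.mono fun q' hq' => hu t ht q' hq'.1 hq'.2.1 hq'.2.2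
  have hω' : ω₁ t =ᶠ[𝓝 q] fun q' =>
      (T - t)⁻¹ * Ω ((q'.1 - 1) / (T - t) ^ γ, q'.2 / (T - t) ^ γ) :=
    hreg.mono fun q' hq' => hω t ht q' hq'.1 hq'.2.1 hq'.2.2
  have hψ' : ψ₁ t =ᶠ[𝓝 q] fun q' =>
      (T - t) ^ (-1 + 2 * γ) * Ψ ((q'.1 - 1) / (T - t) ^ γ, q'.2 / (T - t) ^ γ) :=
    hreg.mono fun q' hq' => hψ t ht q' hq'.1 hq'.2.1 hq'.2.2
  -- earlier times of the window see the fixed point `q` (the window is non-increasing)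
  have hpast : ∀ t' ∈ Ioc T₀ t, 1 - δf t' < q.1 ∧ q.1 < 1 ∧ |q.2| < δf t' := by
    intro t' ht'
    rcases eq_or_lt_of_le ht'.2 with h | h
    · rw [h]; exact ⟨hq1gt, hq1lt, hq2⟩
    · have hmono : δf t ≤ δf t' := hanti ⟨ht'.1, by linarith⟩ ht h.le
      exact ⟨by linarith, hq1lt, lt_of_lt_of_le hq2 hmono⟩
  have hleft : Ioc T₀ t ∈ 𝓝[≤] t := Ioc_mem_nhdsLE ht.1
  have hSt : S ∈ 𝓝 t := Filter.mem_of_superset (isOpen_Ioo.mem_nhds ht) hS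
  have hY1' : ((q.1 - 1) / (T - t) ^ γ, q.2 / (T - t) ^ γ).1 < 0 := by rw [← hYq]; exact hY1
  have hUd : DifferentiableAt ℝ U ((q.1 - 1) / (T - t) ^ γ, q.2 / (T - t) ^ γ) :=
    differentiableAt_of_contDiffOn_leftHalfPlane hU one_ne_zero hY1'
  have hΩd : DifferentiableAt ℝ Ω ((q.1 - 1) / (T - t) ^ γ, q.2 / (T - t) ^ γ) :=
    differentiableAt_of_contDiffOn_leftHalfPlane hΩ one_ne_zero hY1'
  obtain ⟨hdu₁, hdω₁⟩ := hdiff t ht q hq1gt hq1lt hq2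
  have hAu := hasDerivAt_rescale_time (a := -1 + γ / 2) htT hYq (hYq ▸ hUd)
  have hAω := hasDerivAt_rescale_time (a := -1) htT hYq (hYq ▸ hΩd)
  have hdu : timeDerivWithin S u₁ t q = (T - t) ^ (-1 + γ / 2) * (T - t)⁻¹ *
      ((1 - γ / 2) * U Y + γ * (Y.1 * derivR U Y + Y.2 * derivZ U Y)) := by
    rw [timeDerivWithin_apply, derivWithin_of_mem_nhds hSt]
    have hev : (fun t' => u₁ t' q) =ᶠ[𝓝[≤] t] fun t' =>
        (T - t') ^ (-1 + γ / 2) * U ((q.1 - 1) / (T - t') ^ γ, q.2 / (T - t') ^ γ) :=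
      Filter.eventuallyEq_of_mem hleft fun t' ht' => by
        obtain ⟨h1, h2, h3⟩ := hpast t' ht'
        exact hu t' ⟨ht'.1, lt_of_le_of_lt ht'.2 htT⟩ q h1 h2 h3
    rw [deriv_eq_of_eventuallyEq_nhdsLE hdu₁ hAu.differentiableAt hev, hAu.deriv]
    ring
  have hdω : timeDerivWithin S ω₁ t q = (T - t)⁻¹ * (T - t)⁻¹ *
      (Ω Y + γ * (Y.1 * derivR Ω Y + Y.2 * derivZ Ω Y)) := by
    rw [timeDerivWithin_apply, derivWithin_of_mem_nhds hSt]
    have hev : (fun t' => ω₁ t' q) =ᶠ[𝓝[≤] t] fun t' =>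
        (T - t') ^ (-1 : ℝ) * Ω ((q.1 - 1) / (T - t') ^ γ, q.2 / (T - t') ^ γ) :=
      Filter.eventuallyEq_of_mem hleft fun t' ht' => by
        obtain ⟨h1, h2, h3⟩ := hpast t' ht'
        rw [hω t' ⟨ht'.1, lt_of_le_of_lt ht'.2 htT⟩ q h1 h2 h3, Real.rpow_neg_one]
    rw [deriv_eq_of_eventuallyEq_nhdsLE hdω₁ hAω.differentiableAt hev, hAω.deriv,
      Real.rpow_neg_one]
    ring
  exact substitution htT hq1pos hYq hY1 hU hΩ hΨ (hE t ht q hq1gt hq1lt hq2) hu' hω' hψ' hdu hdω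

/-- **The six profile equations (19)–(24) from the ansatz on the shrinking window `𝒲_{δ(t)}`.**
Chae–Tsai's second alternative: `δ(t) > 0` non-increasing on `(T₀, T)` with `δ(t) → 0` and
`limsup_{t↑T} (T−t)^{−γ} δ(t) = ∞` (rendered: for every `N` and every `t₁ < T` there is
`t ∈ (t₁, T) ∩ (T₀, T)` with `N (T−t)^γ < δ(t)`); ansatz and equations on
`𝒲 = {1 − δ(t) < r < 1, |z| < δ(t), T₀ < t < T}`, classical in time there. Then (19)–(24) hold
at every `Y` of the open left half-plane. [cite: ChaeTsai2015, §2 Thm. 1 with (thm2region2)–(thm2region2b) (arXiv p. 4)] -/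
theorem profileSystem_of_window {T₀ : ℝ} {δf : ℝ → ℝ} (hγ : 0 < γ) (hS : Ioo T₀ T ⊆ S)
    (hanti : AntitoneOn δf (Ioo T₀ T)) (hlim : Tendsto δf (𝓝[<] T) (𝓝 0))
    (hsup : ∀ N t₁ : ℝ, t₁ < T → ∃ t ∈ Ioo t₁ T, T₀ < t ∧ N * (T - t) ^ γ < δf t)
    (hU : ContDiffOn ℝ 1 U {Y : ℝ × ℝ | Y.1 < 0}) (hΩ : ContDiffOn ℝ 1 Ω {Y : ℝ × ℝ | Y.1 < 0})
    (hΨ : ContDiffOn ℝ 2 Ψ {Y : ℝ × ℝ | Y.1 < 0})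
    (hE : ∀ t ∈ Ioo T₀ T, ∀ q : ℝ × ℝ, 1 - δf t < q.1 → q.1 < 1 → |q.2| < δf t →
      GeneralizedAxisymNS S 3 0 u₁ ω₁ ψ₁ t q)
    (hu : ∀ t ∈ Ioo T₀ T, ∀ q : ℝ × ℝ, 1 - δf t < q.1 → q.1 < 1 → |q.2| < δf t →
      u₁ t q = (T - t) ^ (-1 + γ / 2) * U ((q.1 - 1) / (T - t) ^ γ, q.2 / (T - t) ^ γ))
    (hω : ∀ t ∈ Ioo T₀ T, ∀ q : ℝ × ℝ, 1 - δf t < q.1 → q.1 < 1 → |q.2| < δf t →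
      ω₁ t q = (T - t)⁻¹ * Ω ((q.1 - 1) / (T - t) ^ γ, q.2 / (T - t) ^ γ))
    (hψ : ∀ t ∈ Ioo T₀ T, ∀ q : ℝ × ℝ, 1 - δf t < q.1 → q.1 < 1 → |q.2| < δf t →
      ψ₁ t q = (T - t) ^ (-1 + 2 * γ) * Ψ ((q.1 - 1) / (T - t) ^ γ, q.2 / (T - t) ^ γ))
    (hdiff : ∀ t ∈ Ioo T₀ T, ∀ q : ℝ × ℝ, 1 - δf t < q.1 → q.1 < 1 → |q.2| < δf t →
      DifferentiableAt ℝ (fun t' => u₁ t' q) t ∧ DifferentiableAt ℝ (fun t' => ω₁ t' q) t)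
    {Y : ℝ × ℝ} (hY1 : Y.1 < 0) :
    ((1 - γ / 2) * U Y + γ * (Y.1 * derivR U Y + Y.2 * derivZ U Y) +
        (-derivZ Ψ Y * derivR U Y + derivR Ψ Y * derivZ U Y) = 0) ∧
    (Ω Y + γ * (Y.1 * derivR Ω Y + Y.2 * derivZ Ω Y) +
        (-derivZ Ψ Y * derivR Ω Y + derivR Ψ Y * derivZ Ω Y) = derivZ (fun Y' => U Y' ^ 2) Y) ∧
    (-(derivR (derivR Ψ) Y + derivZ (derivZ Ψ) Y) = Ω Y) ∧
    (Y.1 * (-derivZ Ψ Y * derivR U Y + derivR Ψ Y * derivZ U Y) + 2 * Ψ Y * derivZ U Y =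
        2 * U Y * derivZ Ψ Y) ∧
    (Y.1 * (-derivZ Ψ Y * derivR Ω Y + derivR Ψ Y * derivZ Ω Y) + 2 * Ψ Y * derivZ Ω Y = 0) ∧
    derivR Ψ Y = 0 := by
  -- late times have `δ(t) < 1`
  have hsmall : ∀ᶠ t in 𝓝[<] T, δf t < 1 := hlim (Iio_mem_nhds zero_lt_one)
  obtain ⟨t₁, ht₁T, ht₁⟩ := (mem_nhdsLT_iff_exists_Ioo_subset).1 hsmall
  set N : ℝ := |Y.1| + |Y.2| + 1 with hN
  have hN0 : 0 < N := by positivity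
  -- admissibility of a time with `N (T−t)^γ < δ(t) < 1`
  have hadm : ∀ t : ℝ, t ∈ Ioo t₁ T → T₀ < t → N * (T - t) ^ γ < δf t →
      t ∈ Ioo T₀ T ∧ (T - t) ^ γ * |Y.1| < min (δf t) 1 ∧ (T - t) ^ γ * |Y.2| < δf t := by
    intro t ht hT₀t hNt
    have hδ1 : δf t < 1 := ht₁ ht
    have hs : 0 < (T - t) ^ γ := Real.rpow_pos_of_pos (sub_pos.2 ht.2) _
    have h1 : (T - t) ^ γ * |Y.1| ≤ N * (T - t) ^ γ := by
      rw [mul_comm N]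
      apply mul_le_mul_of_nonneg_left _ hs.le
      rw [hN]; linarith [abs_nonneg Y.2]
    have h2 : (T - t) ^ γ * |Y.2| ≤ N * (T - t) ^ γ := by
      rw [mul_comm N]
      apply mul_le_mul_of_nonneg_left _ hs.le
      rw [hN]; linarith [abs_nonneg Y.1]
    exact ⟨⟨hT₀t, ht.2⟩, lt_min (by linarith) (by linarith), by linarith⟩
  -- two distinct admissible times
  obtain ⟨ta, hta, hT₀a, hNa⟩ := hsup N (max t₁ T₀) (max_lt ht₁T (by
    obtain ⟨t, ht, hT₀t, -⟩ := hsup 0 t₁ ht₁T; exact lt_trans hT₀t ht.2))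
  have hta₁ : ta ∈ Ioo t₁ T := ⟨lt_of_le_of_lt (le_max_left _ _) hta.1, hta.2⟩
  obtain ⟨tb, htb, hT₀b, hNb⟩ := hsup N ta hta.2
  have htb₁ : tb ∈ Ioo t₁ T := ⟨lt_trans hta₁.1 htb.1, htb.2⟩
  obtain ⟨hta', a3, a4⟩ := hadm ta hta₁ hT₀a hNa
  obtain ⟨htb', b3, b4⟩ := hadm tb htb₁ hT₀b hNb
  obtain ⟨hA16, hA17, hA18⟩ :=
    substitution_at_window hS hanti hU hΩ hΨ hE hu hω hψ hdiff hY1 hta' a3 a4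
  obtain ⟨hB16, hB17, hB18⟩ :=
    substitution_at_window hS hanti hU hΩ hΨ hE hu hω hψ hdiff hY1 htb' b3 b4
  have hne : (T - ta) ^ γ ≠ (T - tb) ^ γ := by
    intro h
    have h' := (Real.rpow_left_inj (sub_pos.2 hta.2).le (sub_pos.2 htb.2).le hγ.ne').1 h
    linarith [htb.1]
  obtain ⟨h19, h22⟩ := coeff_eq_zero_of_two_scales hne hA16 hB16
  obtain ⟨h20, h23⟩ := coeff_eq_zero_of_two_scales hne hA17 hB17
  obtain ⟨h21, h24⟩ := coeff_eq_zero_of_two_scales hne hA18 hB18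
  have h21' : -(derivR (derivR Ψ) Y + derivZ (derivZ Ψ) Y) = Ω Y := by linarith
  have h24' : derivR Ψ Y = 0 := by
    have : -(Y.1 * (derivR (derivR Ψ) Y + derivZ (derivZ Ψ) Y)) - 3 * derivR Ψ Y -
        Y.1 * Ω Y = 0 := h24
    rw [← h21'] at this
    linarith
  refine ⟨h19, by linarith, h21', by linarith, h23, h24'⟩

end Region


end LuoHouAnsatz

/-! ### The theorems as printed: Luo–Hou's ansatz on the fixed region `𝒞_{δ,T}` -/

section Main

open LuoHouAnsatz

variable {S : Set ℝ} {T γ δ : ℝ} {u₁ ω₁ ψ₁ : ℝ → ℝ × ℝ → ℝ} {U Ω Ψ : ℝ × ℝ → ℝ}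

/-- **Chae–Tsai 2015, Theorem 1 (Luo–Hou's self-similar ansatz is trivial under decay).**
Printed: "Let `(u₁, ω₁, ψ₁)` be a classical solution to the system (01)–(03) with the
representation (11)–(13), `0 < γ < ∞`, in the set `𝒞_{δ,T}` […]. We assume the following
asymptotic condition for the blow-up profiles `(U, Ω)`: `|U(Y)| + |Ω(Y)| = o(1)` [as `|Y| → ∞`].
Then `u₁ = ω₁ = 0`, and `ψ₁ = ψ₁(z,t) = a(T−t)^{−1+γ}z + b(T−t)^{−1+2γ}` for some constants
`a, b`." Here (01)–(03) is the `(u₁, ω₁, ψ₁) = (u^θ/r, ω^θ/r, ψ^θ/r)` form of the axisymmetric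
Euler equations (`u₁,t + u^r u₁,r + u^z u₁,z = 2u₁ψ₁,z`, `ω₁,t + u^r ω₁,r + u^z ω₁,z = (u₁²)_z`,
`−(∂_r² + (3/r)∂_r + ∂_z²)ψ₁ = ω₁`, `u^r = −r∂_zψ₁`, `u^z = 2ψ₁ + r∂_rψ₁`) = the tree's
`GeneralizedAxisymNS S 3 0` at each point; (11)–(13) is Luo–Hou's ansatz
`u₁ = (T−t)^{−1+γ/2}U(R,Z)`, `ω₁ = (T−t)^{−1}Ω(R,Z)`, `ψ₁ = (T−t)^{−1+2γ}Ψ(R,Z)`,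
`R = (r−1)/(T−t)^γ`, `Z = z/(T−t)^γ`; `𝒞_{δ,T} = {1−δ < r < 1, −δ < z < δ, T−δ < t < T}`.
**Rendering.** The equations are asked pointwise on `𝒞_{δ,T}` only (time derivatives within
any time set `S ⊇ (T−δ, T)`), the ansatz pointwise on `𝒞_{δ,T}`, the profiles `U, Ω ∈ C¹`,
`Ψ ∈ C²` on the open left half-plane `𝒟 = {R < 0}` (what "classical" gives there; the
boundary line `R = 0` is never reached from `r < 1`), the decay as
`∀ ε > 0 ∃ M ∀ Y ∈ 𝒟, |Y| ≥ M → |U(Y)| + |Ω(Y)| < ε`. Conclusion: `U = Ω = 0` and `Ψ = aZ + b`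
on `𝒟`, hence `u₁ = ω₁ = 0` and `ψ₁ = a(T−t)^{−1+γ}z + b(T−t)^{−1+2γ}` on `𝒞_{δ,T}`.
[cite: ChaeTsai2015, §2 Thm. 1 (J. Nonlinear Sci. 25 (2015) 193–202 = arXiv:1402.4560, pp. 4–5)] -/
theorem chaeTsai2015_luoHouAnsatz_trivial (hγ : 0 < γ) (hδ : 0 < δ) (hS : Ioo (T - δ) T ⊆ S)
    (hU : ContDiffOn ℝ 1 U {Y : ℝ × ℝ | Y.1 < 0}) (hΩ : ContDiffOn ℝ 1 Ω {Y : ℝ × ℝ | Y.1 < 0})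
    (hΨ : ContDiffOn ℝ 2 Ψ {Y : ℝ × ℝ | Y.1 < 0})
    (hE : ∀ t ∈ Ioo (T - δ) T, ∀ q : ℝ × ℝ, 1 - δ < q.1 → q.1 < 1 → |q.2| < δ →
      GeneralizedAxisymNS S 3 0 u₁ ω₁ ψ₁ t q)
    (hu : ∀ t ∈ Ioo (T - δ) T, ∀ q : ℝ × ℝ, 1 - δ < q.1 → q.1 < 1 → |q.2| < δ →
      u₁ t q = (T - t) ^ (-1 + γ / 2) * U ((q.1 - 1) / (T - t) ^ γ, q.2 / (T - t) ^ γ))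
    (hω : ∀ t ∈ Ioo (T - δ) T, ∀ q : ℝ × ℝ, 1 - δ < q.1 → q.1 < 1 → |q.2| < δ →
      ω₁ t q = (T - t)⁻¹ * Ω ((q.1 - 1) / (T - t) ^ γ, q.2 / (T - t) ^ γ))
    (hψ : ∀ t ∈ Ioo (T - δ) T, ∀ q : ℝ × ℝ, 1 - δ < q.1 → q.1 < 1 → |q.2| < δ →
      ψ₁ t q = (T - t) ^ (-1 + 2 * γ) * Ψ ((q.1 - 1) / (T - t) ^ γ, q.2 / (T - t) ^ γ))
    (hdecay : ∀ ε : ℝ, 0 < ε → ∃ M : ℝ, ∀ Y : ℝ × ℝ, Y.1 < 0 → M ≤ ‖Y‖ → |U Y| + |Ω Y| < ε) :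
    ((∀ Y : ℝ × ℝ, Y.1 < 0 → U Y = 0 ∧ Ω Y = 0) ∧
      ∃ a b : ℝ, ∀ Y : ℝ × ℝ, Y.1 < 0 → Ψ Y = a * Y.2 + b) ∧
    ∃ a b : ℝ, ∀ t ∈ Ioo (T - δ) T, ∀ q : ℝ × ℝ, 1 - δ < q.1 → q.1 < 1 → |q.2| < δ →
      u₁ t q = 0 ∧ ω₁ t q = 0 ∧
        ψ₁ t q = a * (T - t) ^ (-1 + γ) * q.2 + b * (T - t) ^ (-1 + 2 * γ) := by
  have hsys := fun Y (hY : (Y : ℝ × ℝ).1 < 0) =>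
    profileSystem_of_region hγ hδ hS hU hΩ hΨ hE hu hω hψ hY
  obtain ⟨hUΩ, a, b, hab⟩ := profile_trivial_of_decay hγ hU hΩ hΨ
    (fun Y hY => (hsys Y hY).1) (fun Y hY => (hsys Y hY).2.1) (fun Y hY => (hsys Y hY).2.2.1)
    (fun Y hY => (hsys Y hY).2.2.2.2.2) hdecay
  refine ⟨⟨hUΩ, a, b, hab⟩, a, b, fun t ht q hq1 hq2 hq3 => ?_⟩
  have hτ : 0 < T - t := by linarith [ht.2]
  have hs : 0 < (T - t) ^ γ := Real.rpow_pos_of_pos hτ _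
  have hY1 : (q.1 - 1) / (T - t) ^ γ < 0 := div_neg_of_neg_of_pos (by linarith) hs
  obtain ⟨hU0, hΩ0⟩ := hUΩ ((q.1 - 1) / (T - t) ^ γ, q.2 / (T - t) ^ γ) hY1
  refine ⟨by rw [hu t ht q hq1 hq2 hq3, hU0, mul_zero], by rw [hω t ht q hq1 hq2 hq3, hΩ0, mul_zero],
    ?_⟩
  rw [hψ t ht q hq1 hq2 hq3, hab _ hY1]
  simp only
  have e : (T - t) ^ (-1 + 2 * γ) / (T - t) ^ γ = (T - t) ^ (-1 + γ) := by
    rw [← Real.rpow_sub hτ]; ring_nf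
  rw [show (T - t) ^ (-1 + 2 * γ) * (a * (q.2 / (T - t) ^ γ) + b) =
      a * ((T - t) ^ (-1 + 2 * γ) / (T - t) ^ γ) * q.2 + b * (T - t) ^ (-1 + 2 * γ) by ring, e]

/-- **Chae–Tsai 2015, Theorem 1 — second alternative: the ansatz on a shrinking window
`𝒲_{δ(t)}`.** Printed: Theorem 1 holds "in either the set `𝒞_{δ,T}` […], or in the set
`𝒲_{δ(t)} := {1 − δ(t) < r < 1, −δ(t) < z < δ(t), T₀ < t < T}` where `δ(t) > 0` is a decreasing
function of `t ∈ (T₀, T)` for some `T₀ < T` and `lim_{t→T−} δ(t) = 0`,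
`limsup_{t→T−} (T−t)^{−γ} δ(t) = ∞`" — i.e. the window may shrink to the ring, but slower than
the self-similar rate `(T−t)^γ` (§4: "the self-similar ansatz may be valid […] only in a
time-dependent region which shrinks to the boundary circle at the self-similar rate").
**Rendering** as in `chaeTsai2015_luoHouAnsatz_trivial`, with: `δ` non-increasing on `(T₀, T)`
(`AntitoneOn`), `δ(t) → 0` along `t ↑ T`, the `limsup = ∞` clause unpacked as "for every `N` and
`t₁ < T` some `t ∈ (t₁, T) ∩ (T₀, T)` has `N(T−t)^γ < δ(t)`", and — the solution being classical
on the cylinder — `u₁(·, q)`, `ω₁(·, q)` differentiable in time at the points of `𝒲` (on `𝒲`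
the ansatz only determines the past of a point, `δ` being non-increasing). Conclusion: `U = Ω = 0`,
`Ψ = aZ + b` on `𝒟`; `u₁ = ω₁ = 0`, `ψ₁ = a(T−t)^{−1+γ}z + b(T−t)^{−1+2γ}` on `𝒲`.
[cite: ChaeTsai2015, §2 Thm. 1 with (thm2region2)–(thm2region2b), §4 Discussion (arXiv pp. 4, 7)] -/
theorem chaeTsai2015_luoHouAnsatz_trivial_of_window {T₀ : ℝ} {δf : ℝ → ℝ} (hγ : 0 < γ)
    (hS : Ioo T₀ T ⊆ S) (hanti : AntitoneOn δf (Ioo T₀ T)) (hlim : Tendsto δf (𝓝[<] T) (𝓝 0))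
    (hsup : ∀ N t₁ : ℝ, t₁ < T → ∃ t ∈ Ioo t₁ T, T₀ < t ∧ N * (T - t) ^ γ < δf t)
    (hU : ContDiffOn ℝ 1 U {Y : ℝ × ℝ | Y.1 < 0}) (hΩ : ContDiffOn ℝ 1 Ω {Y : ℝ × ℝ | Y.1 < 0})
    (hΨ : ContDiffOn ℝ 2 Ψ {Y : ℝ × ℝ | Y.1 < 0})
    (hE : ∀ t ∈ Ioo T₀ T, ∀ q : ℝ × ℝ, 1 - δf t < q.1 → q.1 < 1 → |q.2| < δf t →
      GeneralizedAxisymNS S 3 0 u₁ ω₁ ψ₁ t q)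
    (hu : ∀ t ∈ Ioo T₀ T, ∀ q : ℝ × ℝ, 1 - δf t < q.1 → q.1 < 1 → |q.2| < δf t →
      u₁ t q = (T - t) ^ (-1 + γ / 2) * U ((q.1 - 1) / (T - t) ^ γ, q.2 / (T - t) ^ γ))
    (hω : ∀ t ∈ Ioo T₀ T, ∀ q : ℝ × ℝ, 1 - δf t < q.1 → q.1 < 1 → |q.2| < δf t →
      ω₁ t q = (T - t)⁻¹ * Ω ((q.1 - 1) / (T - t) ^ γ, q.2 / (T - t) ^ γ))
    (hψ : ∀ t ∈ Ioo T₀ T, ∀ q : ℝ × ℝ, 1 - δf t < q.1 → q.1 < 1 → |q.2| < δf t →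
      ψ₁ t q = (T - t) ^ (-1 + 2 * γ) * Ψ ((q.1 - 1) / (T - t) ^ γ, q.2 / (T - t) ^ γ))
    (hdiff : ∀ t ∈ Ioo T₀ T, ∀ q : ℝ × ℝ, 1 - δf t < q.1 → q.1 < 1 → |q.2| < δf t →
      DifferentiableAt ℝ (fun t' => u₁ t' q) t ∧ DifferentiableAt ℝ (fun t' => ω₁ t' q) t)
    (hdecay : ∀ ε : ℝ, 0 < ε → ∃ M : ℝ, ∀ Y : ℝ × ℝ, Y.1 < 0 → M ≤ ‖Y‖ → |U Y| + |Ω Y| < ε) :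
    ((∀ Y : ℝ × ℝ, Y.1 < 0 → U Y = 0 ∧ Ω Y = 0) ∧
      ∃ a b : ℝ, ∀ Y : ℝ × ℝ, Y.1 < 0 → Ψ Y = a * Y.2 + b) ∧
    ∃ a b : ℝ, ∀ t ∈ Ioo T₀ T, ∀ q : ℝ × ℝ, 1 - δf t < q.1 → q.1 < 1 → |q.2| < δf t →
      u₁ t q = 0 ∧ ω₁ t q = 0 ∧
        ψ₁ t q = a * (T - t) ^ (-1 + γ) * q.2 + b * (T - t) ^ (-1 + 2 * γ) := by
  have hsys := fun Y (hY : (Y : ℝ × ℝ).1 < 0) =>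
    profileSystem_of_window hγ hS hanti hlim hsup hU hΩ hΨ hE hu hω hψ hdiff hY
  obtain ⟨hUΩ, a, b, hab⟩ := profile_trivial_of_decay hγ hU hΩ hΨ
    (fun Y hY => (hsys Y hY).1) (fun Y hY => (hsys Y hY).2.1) (fun Y hY => (hsys Y hY).2.2.1)
    (fun Y hY => (hsys Y hY).2.2.2.2.2) hdecay
  refine ⟨⟨hUΩ, a, b, hab⟩, a, b, fun t ht q hq1 hq2 hq3 => ?_⟩
  have hτ : 0 < T - t := by linarith [ht.2]
  have hs : 0 < (T - t) ^ γ := Real.rpow_pos_of_pos hτ _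
  have hY1 : (q.1 - 1) / (T - t) ^ γ < 0 := div_neg_of_neg_of_pos (by linarith) hs
  obtain ⟨hU0, hΩ0⟩ := hUΩ ((q.1 - 1) / (T - t) ^ γ, q.2 / (T - t) ^ γ) hY1
  refine ⟨by rw [hu t ht q hq1 hq2 hq3, hU0, mul_zero], by rw [hω t ht q hq1 hq2 hq3, hΩ0, mul_zero],
    ?_⟩
  rw [hψ t ht q hq1 hq2 hq3, hab _ hY1]
  simp only
  have e : (T - t) ^ (-1 + 2 * γ) / (T - t) ^ γ = (T - t) ^ (-1 + γ) := by
    rw [← Real.rpow_sub hτ]; ring_nf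
  rw [show (T - t) ^ (-1 + 2 * γ) * (a * (q.2 / (T - t) ^ γ) + b) =
      a * ((T - t) ^ (-1 + 2 * γ) / (T - t) ^ γ) * q.2 + b * (T - t) ^ (-1 + 2 * γ) by ring, e]

/-- **Sperone 2017, Proposition 3.1 (Luo–Hou's ansatz without the decay condition).** Printed:
"Let `(u₁, ω₁, ψ₁)` be a classical solution of the system (2.2) having the representation (3.4)
for every `(r,z,t) ∈ 𝒞(δ,T)`, and for some fixed parameter `γ > 0`. Then, the trio leads to an
over-determined system of PDEs that produces two families of solutions: 1. a class of trivial
solutions `u₁ = 0`, `ω₁ = 0`, `ψ₁ = b(T−t)^{−1+γ}z + c(T−t)^{−1+2γ}`; 2. a class of solutions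
that blow-up instantaneously, `u₁ = κ(1−r)^{(γ−2)/(2γ)}`, `ω₁ = 0`, `ψ₁ = c(T−t)^{−1+2γ}`."
Same rendering of "classical solution with the representation on `𝒞_{δ,T}`" as in
`chaeTsai2015_luoHouAnsatz_trivial`, no decay hypothesis; conclusion: the dichotomy both for the
profiles on `𝒟 = {R < 0}` (`U = Ω = 0, Ψ = bZ + c` or `U = κ(−R)^{1/2−1/γ}, Ω = 0, Ψ = c`) and
for `(u₁, ω₁, ψ₁)` on `𝒞_{δ,T}`.
[cite: Sperone2017, §3 Prop. 3.1 (J. Nonlinear Sci. 27 (2017) 1325–1338 = arXiv:1708.09648, pp. 4–8)] -/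
theorem sperone2017_luoHouAnsatz_classification (hγ : 0 < γ) (hδ : 0 < δ)
    (hS : Ioo (T - δ) T ⊆ S)
    (hU : ContDiffOn ℝ 1 U {Y : ℝ × ℝ | Y.1 < 0}) (hΩ : ContDiffOn ℝ 1 Ω {Y : ℝ × ℝ | Y.1 < 0})
    (hΨ : ContDiffOn ℝ 2 Ψ {Y : ℝ × ℝ | Y.1 < 0})
    (hE : ∀ t ∈ Ioo (T - δ) T, ∀ q : ℝ × ℝ, 1 - δ < q.1 → q.1 < 1 → |q.2| < δ →
      GeneralizedAxisymNS S 3 0 u₁ ω₁ ψ₁ t q)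
    (hu : ∀ t ∈ Ioo (T - δ) T, ∀ q : ℝ × ℝ, 1 - δ < q.1 → q.1 < 1 → |q.2| < δ →
      u₁ t q = (T - t) ^ (-1 + γ / 2) * U ((q.1 - 1) / (T - t) ^ γ, q.2 / (T - t) ^ γ))
    (hω : ∀ t ∈ Ioo (T - δ) T, ∀ q : ℝ × ℝ, 1 - δ < q.1 → q.1 < 1 → |q.2| < δ →
      ω₁ t q = (T - t)⁻¹ * Ω ((q.1 - 1) / (T - t) ^ γ, q.2 / (T - t) ^ γ))
    (hψ : ∀ t ∈ Ioo (T - δ) T, ∀ q : ℝ × ℝ, 1 - δ < q.1 → q.1 < 1 → |q.2| < δ →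
      ψ₁ t q = (T - t) ^ (-1 + 2 * γ) * Ψ ((q.1 - 1) / (T - t) ^ γ, q.2 / (T - t) ^ γ)) :
    ((∃ b c : ℝ, ∀ Y : ℝ × ℝ, Y.1 < 0 → U Y = 0 ∧ Ω Y = 0 ∧ Ψ Y = b * Y.2 + c) ∨
      (∃ κ c : ℝ, ∀ Y : ℝ × ℝ, Y.1 < 0 →
        U Y = κ * (-Y.1) ^ (1 / 2 - 1 / γ) ∧ Ω Y = 0 ∧ Ψ Y = c)) ∧
    ((∃ b c : ℝ, ∀ t ∈ Ioo (T - δ) T, ∀ q : ℝ × ℝ, 1 - δ < q.1 → q.1 < 1 → |q.2| < δ →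
        u₁ t q = 0 ∧ ω₁ t q = 0 ∧
          ψ₁ t q = b * (T - t) ^ (-1 + γ) * q.2 + c * (T - t) ^ (-1 + 2 * γ)) ∨
      (∃ κ c : ℝ, ∀ t ∈ Ioo (T - δ) T, ∀ q : ℝ × ℝ, 1 - δ < q.1 → q.1 < 1 → |q.2| < δ →
        u₁ t q = κ * (1 - q.1) ^ ((γ - 2) / (2 * γ)) ∧ ω₁ t q = 0 ∧
          ψ₁ t q = c * (T - t) ^ (-1 + 2 * γ))) := by
  have hsys := fun Y (hY : (Y : ℝ × ℝ).1 < 0) =>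
    profileSystem_of_region hγ hδ hS hU hΩ hΨ hE hu hω hψ hY
  have hclass := profile_classification hγ hU hΩ hΨ
    (fun Y hY => (hsys Y hY).1) (fun Y hY => (hsys Y hY).2.1) (fun Y hY => (hsys Y hY).2.2.1)
    (fun Y hY => (hsys Y hY).2.2.2.1) (fun Y hY => (hsys Y hY).2.2.2.2.1)
    (fun Y hY => (hsys Y hY).2.2.2.2.2)
  refine ⟨hclass, ?_⟩
  -- auxiliary facts at a point of the region
  have aux : ∀ t ∈ Ioo (T - δ) T, ∀ q : ℝ × ℝ, q.1 < 1 →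
      0 < T - t ∧ ((q.1 - 1) / (T - t) ^ γ < 0) ∧
      (T - t) ^ (-1 + 2 * γ) / (T - t) ^ γ = (T - t) ^ (-1 + γ) := by
    intro t ht q hq2
    have hτ : 0 < T - t := by linarith [ht.2]
    have hs : 0 < (T - t) ^ γ := Real.rpow_pos_of_pos hτ _
    refine ⟨hτ, div_neg_of_neg_of_pos (by linarith) hs, ?_⟩
    rw [← Real.rpow_sub hτ]; ring_nf
  rcases hclass with ⟨b, c, hbc⟩ | ⟨κ, c, hκc⟩
  · left
    refine ⟨b, c, fun t ht q hq1 hq2 hq3 => ?_⟩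
    obtain ⟨hτ, hY1, e⟩ := aux t ht q hq2
    obtain ⟨hU0, hΩ0, hΨ0⟩ := hbc ((q.1 - 1) / (T - t) ^ γ, q.2 / (T - t) ^ γ) hY1
    refine ⟨by rw [hu t ht q hq1 hq2 hq3, hU0, mul_zero],
      by rw [hω t ht q hq1 hq2 hq3, hΩ0, mul_zero], ?_⟩
    rw [hψ t ht q hq1 hq2 hq3, hΨ0]
    simp only
    rw [show (T - t) ^ (-1 + 2 * γ) * (b * (q.2 / (T - t) ^ γ) + c) =
      b * ((T - t) ^ (-1 + 2 * γ) / (T - t) ^ γ) * q.2 + c * (T - t) ^ (-1 + 2 * γ) by ring, e]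
  · right
    refine ⟨κ, c, fun t ht q hq1 hq2 hq3 => ?_⟩
    obtain ⟨hτ, hY1, -⟩ := aux t ht q hq2
    have hs : 0 < (T - t) ^ γ := Real.rpow_pos_of_pos hτ _
    obtain ⟨hU0, hΩ0, hΨ0⟩ := hκc ((q.1 - 1) / (T - t) ^ γ, q.2 / (T - t) ^ γ) hY1
    refine ⟨?_, by rw [hω t ht q hq1 hq2 hq3, hΩ0, mul_zero], by
      rw [hψ t ht q hq1 hq2 hq3, hΨ0, mul_comm]⟩
    rw [hu t ht q hq1 hq2 hq3, hU0]
    simp only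
    have h1q : 0 ≤ 1 - q.1 := by linarith
    rw [show -((q.1 - 1) / (T - t) ^ γ) = (1 - q.1) / (T - t) ^ γ by ring,
      Real.div_rpow h1q hs.le, ← Real.rpow_mul hτ.le,
      show (γ - 2) / (2 * γ) = 1 / 2 - 1 / γ by field_simp]
    have hpow : (T - t) ^ (γ * (1 / 2 - 1 / γ)) = (T - t) ^ (-1 + γ / 2) := by
      congr 1; field_simp; ring
    rw [hpow]
    field_simp

end Main

end Literature.Analysis.FluidPDE

end
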